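import Literature.MathematicalPhysics.QuantumFieldTheory.Balaban1983to89.Beta.HessKerRate

/-!
# `Balaban1983to89.Beta.HessKerSchur` — exponentially WEIGHTED SCHUR norms for matrix-fibred kernels and the (5.10)-decay /
# Lipschitz / `GeomRate` chain of the resolvent Hessian kernel `hessKer A V W` WITHOUT RATE HALVING
# (road A2 / (SW1) of the β sub-cell, CONSTANTS half; asymptotic lane asym1, gen 8, v1.1 = v1 + §6–§8 appended)

HONEST FRAMING (cell contract, verbatim): «discharging `BetaPertH` makes Bałaban's UV stability UNCONDITIONAL — a real
constructive-QFT result; it is NOT the continuum limit and NOT the Clay problem.»  THIS MODULE is [folklore] analysis on `ℤ^D`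
(weighted `ℓ¹` operator norms of kernels, Schur's test, telescoping of absolutely convergent lattice sums); it formalises NO
statement printed in Bałaban's papers, cites none as a hypothesis, mints no `Prop` fact, instantiates NO binder of the wall
(RULING (R18-3)) and DISCHARGES NOTHING of it.  NOT summit progress.

ABSOLUTE RULE (cell, verbatim): «No internally-minted statement may enter as a cited fact. Every hypothesis is either
kernel-proved in this package or a verbatim quotation of a PUBLISHED theorem with page reference. The manuscript(s) under
audit are NOT citable for their own disputed steps — they are the thing under adjudication; programme-internal
(2001/route/tribunal) claims are never citable.»  Every theorem below is kernel-proved from explicit, abstract hypotheses on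
matrix-fibred kernels; nothing asserts that any kernel IS Bałaban's.  (v1.1: third sentence restored — XREAD C-lit2g19-5 /
C-asym2g16-1 D1.)

## Why (context only; asserted nowhere below)

`HessKerRate` (gen 7) typed AN2.md §6's elementary implication (CONV-C) ⇒ (SW1) in the POINTWISE decay classes of
`ExpKernelCalculus` (`Decays A C δ`: `|A x y a b| ≤ C e^{−δ|x−y|₁}`; `BiLoc`; `VertexFamily`).  In those classes every composition
halves the rate (`biLoc_comp_decays`: `δ ↦ δ′ < δ` at cost `Zl(δ−δ′)`, used at `δ/2`), every trace costs `Zl(δ/2)`, and the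
output `hessKer A V W μ ν` decays at rate `δ/4` in the coarse variable REGARDLESS of the blocking `N` (`decay510_hessKer`), `δ/8` once
the chain-rule vertex `vertexOfK` is composed in (`HessKerRate` §6 → §4; XREAD C-asym2g14-1 INFO I2).  Road A2's ONE numeric
condition is `c₀ θ^{k₁} (1 + θ) < m − r` (`RemainderConstCertified.thm2Printed_of_marginConst`) with
`c₀ = betaPrime510 D (Lipschitz constant) (rate) = (Lipschitz constant) · Σ_{x ∈ ℤ^D} |x|₁² e^{−rate·|x|₁}`, and the lattice
moment `Σ_{x∈ℤ⁴} |x|₁² e^{−r|x|₁}` is ≈ 8.4·10⁷ at `r = 1/8`, ≈ 1.3·10⁶ at `r = 1/4`, but ≈ 34 at `r = 3/2` (generating-function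
arithmetic, illustration only; not a kernel fact): WHERE the
decay length is lost decides whether a certified list of depth `k₁ ∈ {0, 1}` can ever meet the condition (memo ASYM-beta.md §3.6,
O-asym1-6).  This file redoes the generic half in exponentially WEIGHTED SCHUR NORMS (Brydges-style kernel norms), in which
nothing is lost:

* §1 the classes, in FINITE-PARTIAL-SUM form (no summability hypothesis in a definition): `ColW A R B` — `0 ≤ B` and
  `Σ_{x∈s} Σ_a |A x y a b| e^{R|x−y|₁} ≤ B` for every column `(y, b)` and finite `s` (weighted column sums; `RowW` the row twin);
  `BiW K p q R B` — `Σ_{x∈s} Σ_{y∈t} Σ_{a,b} |K x y a b| e^{R(|x−p|₁ + |y−q|₁)} ≤ B` (weighted bi-localisation); `VertexFamilyW` /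
  `VertexFamily₂W` (the vertex families of `ExpKernelCalculus` §5 in the `BiW` class).  Pointwise consequences (`ColW → Decays A B R`,
  `BiW → BiLoc K p q B R`) and the CONVERSIONS from the pointwise classes at any smaller rate `R < δ`: `colW_of_decays`
  (`B = |F|·C·Zl(δ−R)`), `biW_of_biLoc` (`B = |F|²·C·Zl(δ−R)²`) — so every pointwise supplier still plugs in, paying `Zl` ONCE per factor;
* §2 SCHUR CALCULUS: `biW_comp_colW` — `ColW A R B_A`, `BiW V p q R B_V` ⟹ `BiW (A∘V) p q R (B_A·B_V)` (SAME rate, NO lattice constant);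
  `biW_comp_biW` — `BiW X p p′ R B_X`, `BiW Y q′ q R B_Y` ⟹ `BiW (X∘Y) p q R (B_X·B_Y·e^{−R|p′−q′|₁})` (a GAIN); `abs_tr_le_biW` —
  `|tr K| ≤ B·e^{−R|p−q|₁}` (a GAIN, no `Zl`); hence `abs_tadpole_le_W` (`≤ B_A B_W e^{−R|p−q|₁}`) and `abs_bubble_le_W`
  (`≤ B_A² B_V B_W e^{−2R|p−q|₁}`);
* §3 **`decay510_hessKer_W`**: `|hessKer A V W μ ν z| ≤ hessW·e^{−(R·N)|z|₁}`, `hessW = ½B_A B_W + ½(B_A B_V)²` — decay length `R·N`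
  in the COARSE variable (the vertices sit at `N • z`), against `δ/4` of `ExpKernelCalculus.decay510_hessKer`; `absMoment₂_hessKer_W`;
* §4 the LIPSCHITZ twin **`decay510_hessKer_sub_W`** (constant `lipW`, LINEAR in the deviations `εA, εV, εW` (`lipW_mul`), equal to
  `hessW` at zero reference (`lipW_zero_ref`), same rate `R·N`), from `HessKerRate`'s difference identities (`comp_sub_comp`,
  `comp_sub_comp_bb`, `tadpole_sub_tadpole`, `bubble_sub_bubble`) and the subadditivity `BiW.add`;
* §5 RATES: `uniformDecay_hessKer_W`, `geometricRate_hessKer_W`, **`geomRate_secondMoment_hessKer_W`** —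
  `RateCertificate.GeomRate (j ↦ secondMoment (hessKer (A j) (V j) (W j)) μ ν) (secondMoment (hessKer A∞ V∞ W∞) μ ν)
  (betaPrime510 D (lipW B_A B_A B_V B_V B_W cA cV cW) (R·N)) θ` — (SW1)'s shape with the constant budgeted at decay length `R·N`
  (`tendsto_…`, `oneLoopDrift_secondMoment_hessKer_W` = the road-A2 socket `Drift.OneLoopDrift` by name);
  and `geomRate_secondMoment_hessKer_W_of_pointwise`: the SAME conclusion from `HessKerRate` §4's pointwise hypotheses at any
  `0 < R < δ` (rate `R·N` instead of `δ/4`; e.g. `R = δ/2`, `N = 3`: decay length ×6, lattice moment smaller by orders of magnitude);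
* §6 (v1.1) HALF-RATE FIRST-ORDER VERTICES SUFFICE: the bubble carries TWO localisation legs, so `ColW A R`, `VertexFamilyW V N (R/2)`,
  `VertexFamily₂W W N R` already give rate `R·N` — **`decay510_hessKer_halfV`**, **`decay510_hessKer_sub_halfV`** (same constants
  `hessW`, `lipW`), `geomRate_secondMoment_hessKer_halfV`, `oneLoopDrift_secondMoment_hessKer_halfV`; rate monotonicity `ColW.of_le` &c.;
* §7 (v1.1) THE CHAIN-RULE VERTEX IN THE WEIGHTED CLASSES: `biW_wsum_W` (weighted superpositions), `LocStencilW` (+ conversion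
  `locStencilW_of_locStencil`), **`vertexFamilyW_vertexOfK`** — `ColW K R B_K`, `LocStencilW S (R/2) B_s` ⟹
  `VertexFamilyW (vertexOfK K N S) N (R/2) (B_K·B_s)` (exactly §6's slot; no lattice constant, no `d+1`), its Lipschitz twin
  **`vertexFamilyW_vertexOfK_sub`** (`εK·B_s + B_K′·εS`) and rate form, and the END-TO-END statement from the PRIMITIVES `(K_j, S_j, W_j)`
  in the literal shape `hessKer K (vertexOfK K N S) W` of `OneStepKernelFamily.TstepOf`: **`geomRate_secondMoment_hessKer_primitivesW`**,
  constant `betaPrime510 (d+1) (lipW B_K B_K (B_K B_s) (B_K B_s) B_W c_K (c_K B_s + B_K c_S) c_W) (R·N)` — the decay length of the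
  step kernel's second-moment rate bound is the RESOLVENT'S WEIGHTED COLUMN RATE times the blocking (pointwise chain: `δ/8`);
* §8 (v1.1) UNITS: `colW_scaleK`, `rowW_scaleK`, `biW_scaleK`, `vertexFamilyW_scaleK`, `vertexFamily₂W_scaleK` — the weighted classes
  transport under the fibrewise rescaling `HessKerRate.scaleK u v` (bound `U·B·U′`, same rate), as RULING (R25-1)'s rescaled
  constituents require (`HessKerRate` §5 `hessKer_scaleK`).

PRINT CONTEXT (attribution of the NORM, not a hypothesis; nothing below uses it): exponentially weighted sup–sum kernel norms
`sup_y Σ_{y′} e^{(1−α)δ₀ d(y,y′)} |K(y,y′)|` are the norms in which Bałaban states his propagator bounds and sums his random-walk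
expansions — `Balaban1984PropagatorsII` (CMP 96) Lemma 2.1, (2.61)–(2.63), p. 234, and Prop. 2.2 / (2.67) («The random walk
representation (2.50) is convergent in the norms defined by these inequalities», p. 234) [corpus:paper:balaban1984-cmp96-propagators-rt-ii
p. 12]; the submultiplicativity under composition is Schur's / Young's test with the triangle inequality in the exponent (textbook).
So a supplier of the (α) / (CONV-C) data built from those expansions, or from a Combes–Thomas OPERATOR bound, delivers `ColW` / `BiW`
data natively, with no pointwise ↔ summed conversion loss.

RELATION TO THE TREE (no duplication): `ExpKernelCalculus` / `KernelWard` / `HessKerRate` = pointwise classes; `CombesThomasFormOp` =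
weighted `ℓ²` (set-to-set) form of Combes–Thomas; `T4RateAlgebra` = scalar translation-invariant `RatePair`s.  A weighted-`ℓ¹`
(Schur) calculus for the two-point matrix-fibred kernels `MKer D F` in which `OneStepKernelFamily.TstepOf` / `TbalOf` are typed did
not exist.  Resolvent suppliers that come with Combes–Thomas operator bounds land in `ColW` NATIVELY (no `Zl` at all).

WHAT IS NOT HERE (located, NOT in print, NOT claimed): the hypotheses of §5 for Bałaban's (rescaled, RULING (R25-1)) step
constituents — the `j`-uniform data are (α)-type inputs, the GEOMETRIC CONVERGENCE of the primitives is AN2.md §6 (CONV-C) (OPEN;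
O-an2-2 / O-asym1-1), the typed step jets `JsBal` ((i′), an2); any identification with Bałaban's `β⁰`; any numeric value of
`B_A, B_V, B_W, R` for Bałaban's kernels.  NOT continuum, NOT Clay.
-/

open Finset Filter
open scoped BigOperators
open Literature.MathematicalPhysics.QuantumFieldTheory.Balaban1983to89
open Literature.MathematicalPhysics.QuantumFieldTheory.Balaban1983to89.Beta
open B12Sec2to5 (l1 l1_nonneg Decay510 betaPrime510)
open ExpKernelCalculus (MKer Decays BiLoc comp tr bubble tadpole VertexFamily VertexFamily₂ hessKer Zl Zl_nonneg
  l1_natSmul l1_sub_symm l1_sub_triangle summable_exp_shift summable_exp_shift' tsum_exp_shift tsum_exp_shift')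
open HessKerRate (comp_sub_comp comp_sub_comp_bb tadpole_sub_tadpole bubble_sub_bubble)

namespace Literature.MathematicalPhysics.QuantumFieldTheory.Balaban1983to89.Beta.HessKerSchur

noncomputable section

variable {D : ℕ} {F : Type*} [Fintype F]

/-! ## §1 Weighted Schur classes -/

/-- WEIGHTED ROW SUMS: `0 ≤ B` and `Σ_{y∈s} Σ_b |K x y a b|·e^{R|x−y|₁} ≤ B` for every row `(x, a)` and every finite `s`
(the sign is recorded so that an empty fibre carries no junk). [folklore] -/
def RowW (K : MKer D F) (R B : ℝ) : Prop :=
  0 ≤ B ∧ ∀ (x : Fin D → ℤ) (a : F) (s : Finset (Fin D → ℤ)), ∑ y ∈ s, ∑ b, |K x y a b| * Real.exp (R * l1 (x - y)) ≤ B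

/-- WEIGHTED COLUMN SUMS: `0 ≤ B` and `Σ_{x∈s} Σ_a |K x y a b|·e^{R|x−y|₁} ≤ B` for every column `(y, b)` and every finite `s`. [folklore] -/
def ColW (K : MKer D F) (R B : ℝ) : Prop :=
  0 ≤ B ∧ ∀ (y : Fin D → ℤ) (b : F) (s : Finset (Fin D → ℤ)), ∑ x ∈ s, ∑ a, |K x y a b| * Real.exp (R * l1 (x - y)) ≤ B

/-- WEIGHTED BI-LOCALISATION at `(p, q)`: `Σ_{x∈s} Σ_{y∈t} Σ_{a,b} |K x y a b|·e^{R(|x−p|₁ + |y−q|₁)} ≤ B` for all finite `s, t`. [folklore] -/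
def BiW (K : MKer D F) (p q : Fin D → ℤ) (R B : ℝ) : Prop :=
  ∀ s t : Finset (Fin D → ℤ), ∑ x ∈ s, ∑ y ∈ t, ∑ a, ∑ b, |K x y a b| * Real.exp (R * (l1 (x - p) + l1 (y - q))) ≤ B

/-- First-order VERTEX FAMILY in the weighted class: `V μ y` is `BiW` at `(N • y, N • y)`. [folklore] -/
def VertexFamilyW (V : Fin D → (Fin D → ℤ) → MKer D F) (N : ℕ) (R B : ℝ) : Prop :=
  ∀ μ y, BiW (V μ y) ((N : ℤ) • y) ((N : ℤ) • y) R B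

/-- Second-order VERTEX FAMILY in the weighted class: `W μ y ν y′` is `BiW` at `(N • y, N • y′)`. [folklore] -/
def VertexFamily₂W (W : Fin D → (Fin D → ℤ) → Fin D → (Fin D → ℤ) → MKer D F) (N : ℕ) (R B : ℝ) : Prop :=
  ∀ μ y ν y', BiW (W μ y ν y') ((N : ℤ) • y) ((N : ℤ) • y') R B

/-- The bound of a `RowW` class is nonnegative. [folklore] -/
theorem RowW.nonneg {K : MKer D F} {R B : ℝ} (h : RowW K R B) : 0 ≤ B := h.1

/-- The bound of a `ColW` class is nonnegative. [folklore] -/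
theorem ColW.nonneg {K : MKer D F} {R B : ℝ} (h : ColW K R B) : 0 ≤ B := h.1

omit [Fintype F] in
/-- The bound of a `BiW` class is nonnegative. [folklore] -/
theorem BiW.nonneg [Fintype F] {K : MKer D F} {p q : Fin D → ℤ} {R B : ℝ} (h : BiW K p q R B) : 0 ≤ B := by
  simpa using h ∅ ∅

/-- A single weighted entry is below the row bound. [folklore] -/
theorem RowW.entry_le {K : MKer D F} {R B : ℝ} (h : RowW K R B) (x y : Fin D → ℤ) (a b : F) :
    |K x y a b| * Real.exp (R * l1 (x - y)) ≤ B := by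
  classical
  have h1 := h.2 x a {y}
  rw [Finset.sum_singleton] at h1
  exact le_trans (Finset.single_le_sum (f := fun b => |K x y a b| * Real.exp (R * l1 (x - y)))
    (fun b _ => by positivity) (Finset.mem_univ b)) h1

/-- A single weighted entry is below the column bound. [folklore] -/
theorem ColW.entry_le {K : MKer D F} {R B : ℝ} (h : ColW K R B) (x y : Fin D → ℤ) (a b : F) :
    |K x y a b| * Real.exp (R * l1 (x - y)) ≤ B := by
  classical
  have h1 := h.2 y b {x}
  rw [Finset.sum_singleton] at h1
  exact le_trans (Finset.single_le_sum (f := fun a => |K x y a b| * Real.exp (R * l1 (x - y)))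
    (fun a _ => by positivity) (Finset.mem_univ a)) h1

/-- A single weighted entry is below the bi-localisation bound. [folklore] -/
theorem BiW.entry_le {K : MKer D F} {p q : Fin D → ℤ} {R B : ℝ} (h : BiW K p q R B) (x y : Fin D → ℤ) (a b : F) :
    |K x y a b| * Real.exp (R * (l1 (x - p) + l1 (y - q))) ≤ B := by
  classical
  have h1 := h {x} {y}
  rw [Finset.sum_singleton, Finset.sum_singleton] at h1
  refine le_trans ?_ h1
  refine le_trans ?_ (Finset.single_le_sum (f := fun a => ∑ b, |K x y a b| * Real.exp (R * (l1 (x - p) + l1 (y - q))))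
    (fun a _ => Finset.sum_nonneg fun b _ => by positivity) (Finset.mem_univ a))
  exact Finset.single_le_sum (f := fun b => |K x y a b| * Real.exp (R * (l1 (x - p) + l1 (y - q))))
    (fun b _ => by positivity) (Finset.mem_univ b)

/-- `e^{Rℓ}·e^{−Rℓ}`-bookkeeping: `t·e^{Rℓ} ≤ B ⟹ t ≤ B·e^{−Rℓ}`. [folklore] -/
theorem le_mul_exp_neg_of_mul_exp_le {t B R ℓ : ℝ} (h : t * Real.exp (R * ℓ) ≤ B) : t ≤ B * Real.exp (-R * ℓ) := by
  have hpos := Real.exp_pos (R * ℓ)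
  have : t = t * Real.exp (R * ℓ) * Real.exp (-R * ℓ) := by
    rw [mul_assoc, ← Real.exp_add, show R * ℓ + -R * ℓ = 0 by ring, Real.exp_zero, mul_one]
  rw [this]
  exact mul_le_mul_of_nonneg_right h (Real.exp_pos _).le

/-- **`RowW ⟹ Decays`** (pointwise, SAME rate `R`, constant `B`). [folklore] -/
theorem RowW.decays {K : MKer D F} {R B : ℝ} (h : RowW K R B) : Decays K B R :=
  fun x y a b => le_mul_exp_neg_of_mul_exp_le (h.entry_le x y a b)

/-- **`ColW ⟹ Decays`** (pointwise, SAME rate `R`, constant `B`). [folklore] -/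
theorem ColW.decays {K : MKer D F} {R B : ℝ} (h : ColW K R B) : Decays K B R :=
  fun x y a b => le_mul_exp_neg_of_mul_exp_le (h.entry_le x y a b)

/-- **`BiW ⟹ BiLoc`** (pointwise, SAME rate `R`, constant `B`). [folklore] -/
theorem BiW.biLoc {K : MKer D F} {p q : Fin D → ℤ} {R B : ℝ} (h : BiW K p q R B) : BiLoc K p q B R :=
  fun x y a b => le_mul_exp_neg_of_mul_exp_le (h.entry_le x y a b)

/-- `VertexFamilyW ⟹ VertexFamily` (pointwise). [folklore] -/
theorem VertexFamilyW.vertexFamily {V : Fin D → (Fin D → ℤ) → MKer D F} {N : ℕ} {R B : ℝ} (h : VertexFamilyW V N R B) :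
    VertexFamily V N B R :=
  fun μ y => (h μ y).biLoc

/-- `VertexFamily₂W ⟹ VertexFamily₂` (pointwise). [folklore] -/
theorem VertexFamily₂W.vertexFamily₂ {W : Fin D → (Fin D → ℤ) → Fin D → (Fin D → ℤ) → MKer D F} {N : ℕ} {R B : ℝ}
    (h : VertexFamily₂W W N R B) : VertexFamily₂ W N B R :=
  fun μ y ν y' => (h μ y ν y').biLoc

/-- Monotonicity of `ColW` in the bound. [folklore] -/
theorem ColW.mono {K : MKer D F} {R B B' : ℝ} (h : ColW K R B) (hB : B ≤ B') : ColW K R B' :=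
  ⟨h.1.trans hB, fun y b s => (h.2 y b s).trans hB⟩

/-- Monotonicity of `BiW` in the bound. [folklore] -/
theorem BiW.mono {K : MKer D F} {p q : Fin D → ℤ} {R B B' : ℝ} (h : BiW K p q R B) (hB : B ≤ B') : BiW K p q R B' :=
  fun s t => (h s t).trans hB

/-- Monotonicity of `VertexFamilyW` in the bound. [folklore] -/
theorem VertexFamilyW.mono {V : Fin D → (Fin D → ℤ) → MKer D F} {N : ℕ} {R B B' : ℝ} (h : VertexFamilyW V N R B) (hB : B ≤ B') :
    VertexFamilyW V N R B' :=
  fun μ y => (h μ y).mono hB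

/-- Monotonicity of `VertexFamily₂W` in the bound. [folklore] -/
theorem VertexFamily₂W.mono {W : Fin D → (Fin D → ℤ) → Fin D → (Fin D → ℤ) → MKer D F} {N : ℕ} {R B B' : ℝ}
    (h : VertexFamily₂W W N R B) (hB : B ≤ B') : VertexFamily₂W W N R B' :=
  fun μ y ν y' => (h μ y ν y').mono hB

/-- `BiW` is subadditive: `BiW X B₁`, `BiW Y B₂` ⟹ `BiW (X + Y) (B₁ + B₂)`. [folklore] -/
theorem BiW.add {X Y : MKer D F} {p q : Fin D → ℤ} {R B₁ B₂ : ℝ} (hX : BiW X p q R B₁) (hY : BiW Y p q R B₂) :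
    BiW (X + Y) p q R (B₁ + B₂) := by
  intro s t
  have hX1 := hX s t
  have hY1 := hY s t
  calc ∑ x ∈ s, ∑ y ∈ t, ∑ a, ∑ b, |(X + Y) x y a b| * Real.exp (R * (l1 (x - p) + l1 (y - q)))
      ≤ ∑ x ∈ s, ∑ y ∈ t, ∑ a, ∑ b, (|X x y a b| * Real.exp (R * (l1 (x - p) + l1 (y - q))) +
          |Y x y a b| * Real.exp (R * (l1 (x - p) + l1 (y - q)))) := by
        gcongr with x _ y _ a _ b _
        rw [← add_mul]
        exact mul_le_mul_of_nonneg_right (abs_add_le _ _) (Real.exp_pos _).le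
    _ = (∑ x ∈ s, ∑ y ∈ t, ∑ a, ∑ b, |X x y a b| * Real.exp (R * (l1 (x - p) + l1 (y - q)))) +
          ∑ x ∈ s, ∑ y ∈ t, ∑ a, ∑ b, |Y x y a b| * Real.exp (R * (l1 (x - p) + l1 (y - q))) := by
        simp only [Finset.sum_add_distrib]
    _ ≤ B₁ + B₂ := add_le_add hX1 hY1

/-- **POINTWISE ⟹ WEIGHTED (columns)**: `Decays A C δ`, `R < δ` ⟹ `ColW A R (|F|·C·Zl(δ−R))`. [folklore] -/
theorem colW_of_decays {A : MKer D F} {C δ R : ℝ} (hA : Decays A C δ) (hR : R < δ) :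
    ColW A R ((Fintype.card F : ℝ) * C * Zl D (δ - R)) := by
  classical
  rcases isEmpty_or_nonempty F with hF | ⟨⟨a₀⟩⟩
  · exact ⟨by simp, fun y b s => by simp⟩
  have hC : 0 ≤ C := hA.nonneg a₀
  refine ⟨by have := Zl_nonneg (D := D) (show 0 < δ - R by linarith); positivity, fun y b s => ?_⟩
  have hterm : ∀ x ∈ s, ∑ a, |A x y a b| * Real.exp (R * l1 (x - y)) ≤
      (Fintype.card F : ℝ) * C * Real.exp (-(δ - R) * l1 (x - y)) := by
    intro x _
    calc ∑ a, |A x y a b| * Real.exp (R * l1 (x - y))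
        ≤ ∑ _a : F, C * Real.exp (-(δ - R) * l1 (x - y)) := Finset.sum_le_sum fun a _ => by
          calc |A x y a b| * Real.exp (R * l1 (x - y)) ≤ C * Real.exp (-δ * l1 (x - y)) * Real.exp (R * l1 (x - y)) :=
                mul_le_mul_of_nonneg_right (hA x y a b) (Real.exp_pos _).le
            _ = C * Real.exp (-(δ - R) * l1 (x - y)) := by
                rw [mul_assoc, ← Real.exp_add]; ring_nf
      _ = (Fintype.card F : ℝ) * C * Real.exp (-(δ - R) * l1 (x - y)) := by
          rw [Finset.sum_const, Finset.card_univ, nsmul_eq_mul]; ring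
  have hs := summable_exp_shift (show 0 < δ - R by linarith) y
  have hs' : Summable fun x : Fin D → ℤ => Real.exp (-(δ - R) * l1 (x - y)) := by
    refine (summable_exp_shift' (show 0 < δ - R by linarith) y).congr fun x => ?_; rfl
  calc ∑ x ∈ s, ∑ a, |A x y a b| * Real.exp (R * l1 (x - y))
      ≤ ∑ x ∈ s, (Fintype.card F : ℝ) * C * Real.exp (-(δ - R) * l1 (x - y)) := Finset.sum_le_sum hterm
    _ = (Fintype.card F : ℝ) * C * ∑ x ∈ s, Real.exp (-(δ - R) * l1 (x - y)) := by rw [Finset.mul_sum]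
    _ ≤ (Fintype.card F : ℝ) * C * ∑' x : Fin D → ℤ, Real.exp (-(δ - R) * l1 (x - y)) :=
        mul_le_mul_of_nonneg_left (hs'.sum_le_tsum s (fun x _ => (Real.exp_pos _).le)) (by positivity)
    _ = (Fintype.card F : ℝ) * C * Zl D (δ - R) := by rw [tsum_exp_shift']

/-- **POINTWISE ⟹ WEIGHTED (rows)**: `Decays A C δ`, `R < δ` ⟹ `RowW A R (|F|·C·Zl(δ−R))`. [folklore] -/
theorem rowW_of_decays {A : MKer D F} {C δ R : ℝ} (hA : Decays A C δ) (hR : R < δ) :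
    RowW A R ((Fintype.card F : ℝ) * C * Zl D (δ - R)) := by
  classical
  rcases isEmpty_or_nonempty F with hF | ⟨⟨a₀⟩⟩
  · exact ⟨by simp, fun x a s => by simp⟩
  have hC : 0 ≤ C := hA.nonneg a₀
  refine ⟨by have := Zl_nonneg (D := D) (show 0 < δ - R by linarith); positivity, fun x a s => ?_⟩
  have hterm : ∀ y ∈ s, ∑ b, |A x y a b| * Real.exp (R * l1 (x - y)) ≤
      (Fintype.card F : ℝ) * C * Real.exp (-(δ - R) * l1 (x - y)) := by
    intro y _
    calc ∑ b, |A x y a b| * Real.exp (R * l1 (x - y))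
        ≤ ∑ _b : F, C * Real.exp (-(δ - R) * l1 (x - y)) := Finset.sum_le_sum fun b _ => by
          calc |A x y a b| * Real.exp (R * l1 (x - y)) ≤ C * Real.exp (-δ * l1 (x - y)) * Real.exp (R * l1 (x - y)) :=
                mul_le_mul_of_nonneg_right (hA x y a b) (Real.exp_pos _).le
            _ = C * Real.exp (-(δ - R) * l1 (x - y)) := by
                rw [mul_assoc, ← Real.exp_add]; ring_nf
      _ = (Fintype.card F : ℝ) * C * Real.exp (-(δ - R) * l1 (x - y)) := by
          rw [Finset.sum_const, Finset.card_univ, nsmul_eq_mul]; ring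
  have hs := summable_exp_shift (show 0 < δ - R by linarith) x
  calc ∑ y ∈ s, ∑ b, |A x y a b| * Real.exp (R * l1 (x - y))
      ≤ ∑ y ∈ s, (Fintype.card F : ℝ) * C * Real.exp (-(δ - R) * l1 (x - y)) := Finset.sum_le_sum hterm
    _ = (Fintype.card F : ℝ) * C * ∑ y ∈ s, Real.exp (-(δ - R) * l1 (x - y)) := by rw [Finset.mul_sum]
    _ ≤ (Fintype.card F : ℝ) * C * ∑' y : Fin D → ℤ, Real.exp (-(δ - R) * l1 (x - y)) :=
        mul_le_mul_of_nonneg_left (hs.sum_le_tsum s (fun y _ => (Real.exp_pos _).le)) (by positivity)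
    _ = (Fintype.card F : ℝ) * C * Zl D (δ - R) := by rw [tsum_exp_shift]

/-- **POINTWISE ⟹ WEIGHTED (bi-localised)**: `BiLoc K p q C δ`, `R < δ` ⟹ `BiW K p q R (|F|²·C·Zl(δ−R)²)`. [folklore] -/
theorem biW_of_biLoc {K : MKer D F} {p q : Fin D → ℤ} {C δ R : ℝ} (hK : BiLoc K p q C δ) (hR : R < δ) :
    BiW K p q R ((Fintype.card F : ℝ) ^ 2 * C * Zl D (δ - R) ^ 2) := by
  classical
  intro s t
  rcases isEmpty_or_nonempty F with hF | ⟨⟨a₀⟩⟩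
  · simp
  have hC : 0 ≤ C := hK.nonneg a₀
  have hδR : 0 < δ - R := by linarith
  -- termwise
  have hterm : ∀ x y (a b : F), |K x y a b| * Real.exp (R * (l1 (x - p) + l1 (y - q))) ≤
      C * (Real.exp (-(δ - R) * l1 (x - p)) * Real.exp (-(δ - R) * l1 (y - q))) := by
    intro x y a b
    calc |K x y a b| * Real.exp (R * (l1 (x - p) + l1 (y - q)))
        ≤ C * Real.exp (-δ * (l1 (x - p) + l1 (y - q))) * Real.exp (R * (l1 (x - p) + l1 (y - q))) :=
          mul_le_mul_of_nonneg_right (hK x y a b) (Real.exp_pos _).le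
      _ = C * (Real.exp (-(δ - R) * l1 (x - p)) * Real.exp (-(δ - R) * l1 (y - q))) := by
          rw [mul_assoc, ← Real.exp_add, ← Real.exp_add]; ring_nf
  have hSx : ∑ x ∈ s, Real.exp (-(δ - R) * l1 (x - p)) ≤ Zl D (δ - R) := by
    rw [← tsum_exp_shift' (c := δ - R) p]
    exact (summable_exp_shift' hδR p).sum_le_tsum s (fun x _ => (Real.exp_pos _).le)
  have hSy : ∑ y ∈ t, Real.exp (-(δ - R) * l1 (y - q)) ≤ Zl D (δ - R) := by
    rw [← tsum_exp_shift' (c := δ - R) q]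
    exact (summable_exp_shift' hδR q).sum_le_tsum t (fun y _ => (Real.exp_pos _).le)
  have hSx0 : 0 ≤ ∑ x ∈ s, Real.exp (-(δ - R) * l1 (x - p)) := Finset.sum_nonneg fun _ _ => (Real.exp_pos _).le
  have hSy0 : 0 ≤ ∑ y ∈ t, Real.exp (-(δ - R) * l1 (y - q)) := Finset.sum_nonneg fun _ _ => (Real.exp_pos _).le
  calc ∑ x ∈ s, ∑ y ∈ t, ∑ a, ∑ b, |K x y a b| * Real.exp (R * (l1 (x - p) + l1 (y - q)))
      ≤ ∑ x ∈ s, ∑ y ∈ t, ∑ _a : F, ∑ _b : F, C * (Real.exp (-(δ - R) * l1 (x - p)) * Real.exp (-(δ - R) * l1 (y - q))) := by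
        exact Finset.sum_le_sum fun x _ => Finset.sum_le_sum fun y _ => Finset.sum_le_sum fun a _ =>
          Finset.sum_le_sum fun b _ => hterm x y a b
    _ = (Fintype.card F : ℝ) ^ 2 * C * ((∑ x ∈ s, Real.exp (-(δ - R) * l1 (x - p))) *
          ∑ y ∈ t, Real.exp (-(δ - R) * l1 (y - q))) := by
        simp only [Finset.sum_const, Finset.card_univ, nsmul_eq_mul]
        rw [Finset.sum_mul_sum]
        simp only [Finset.mul_sum]
        refine Finset.sum_congr rfl fun x _ => Finset.sum_congr rfl fun y _ => ?_
        ring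
    _ ≤ (Fintype.card F : ℝ) ^ 2 * C * (Zl D (δ - R) * Zl D (δ - R)) :=
        mul_le_mul_of_nonneg_left (mul_le_mul hSx hSy hSy0 (Zl_nonneg hδR)) (by positivity)
    _ = (Fintype.card F : ℝ) ^ 2 * C * Zl D (δ - R) ^ 2 := by ring

/-- `VertexFamily V N Cv δ`, `R < δ` ⟹ `VertexFamilyW V N R (|F|²·Cv·Zl(δ−R)²)`. [folklore] -/
theorem vertexFamilyW_of_vertexFamily {V : Fin D → (Fin D → ℤ) → MKer D F} {N : ℕ} {Cv δ R : ℝ} (hV : VertexFamily V N Cv δ)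
    (hR : R < δ) : VertexFamilyW V N R ((Fintype.card F : ℝ) ^ 2 * Cv * Zl D (δ - R) ^ 2) :=
  fun μ y => biW_of_biLoc (hV μ y) hR

/-- `VertexFamily₂ W N Cw δ`, `R < δ` ⟹ `VertexFamily₂W W N R (|F|²·Cw·Zl(δ−R)²)`. [folklore] -/
theorem vertexFamily₂W_of_vertexFamily₂ {W : Fin D → (Fin D → ℤ) → Fin D → (Fin D → ℤ) → MKer D F} {N : ℕ} {Cw δ R : ℝ}
    (hW : VertexFamily₂ W N Cw δ) (hR : R < δ) : VertexFamily₂W W N R ((Fintype.card F : ℝ) ^ 2 * Cw * Zl D (δ - R) ^ 2) :=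
  fun μ y ν y' => biW_of_biLoc (hW μ y ν y') hR

/-! ## §2 Schur calculus: compositions, traces, bubble and tadpole -/

/-- Finite sums against `tsum`s of NONNEGATIVE families: if every finite `y`-partial sum of `Σ_{i∈I} m i y` is `≤ M`, then each
`m i` is summable and `Σ_{i∈I} Σ'_y m i y ≤ M`. [folklore] -/
theorem sum_tsum_le {ι : Type*} (I : Finset ι) {m : ι → (Fin D → ℤ) → ℝ} (h0 : ∀ i y, 0 ≤ m i y) {M : ℝ}
    (hM : ∀ u : Finset (Fin D → ℤ), ∑ y ∈ u, ∑ i ∈ I, m i y ≤ M) :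
    (∀ i ∈ I, Summable (m i)) ∧ ∑ i ∈ I, ∑' y, m i y ≤ M := by
  classical
  have hs : ∀ i ∈ I, Summable (m i) := by
    intro i hi
    refine summable_of_sum_le (c := M) (fun y => h0 i y) fun u => ?_
    calc ∑ y ∈ u, m i y ≤ ∑ y ∈ u, ∑ j ∈ I, m j y :=
          Finset.sum_le_sum fun y _ => Finset.single_le_sum (f := fun j => m j y) (fun j _ => h0 j y) hi
      _ ≤ M := hM u
  refine ⟨hs, ?_⟩
  rw [← Summable.tsum_finsetSum hs]
  exact (summable_sum fun i hi => hs i hi).tsum_le_of_sum_le hM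

/-- The finite-sum REORDERING behind Schur's test for a composition: `Σ_x Σ_z Σ_a Σ_b Σ_f P(x,a,f)·Q(z,f,b)
= Σ_f (Σ_x Σ_a P(x,a,f))·(Σ_z Σ_b Q(z,f,b))`. [folklore] -/
theorem sum_reorder (s t : Finset (Fin D → ℤ)) (P : (Fin D → ℤ) → F → F → ℝ) (Q : (Fin D → ℤ) → F → F → ℝ) :
    ∑ x ∈ s, ∑ z ∈ t, ∑ a, ∑ b, ∑ f, P x a f * Q z f b =
      ∑ f, (∑ x ∈ s, ∑ a, P x a f) * (∑ z ∈ t, ∑ b, Q z f b) := by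
  have h1 : ∀ f, (∑ x ∈ s, ∑ a, P x a f) * (∑ z ∈ t, ∑ b, Q z f b) =
      ∑ x ∈ s, ∑ z ∈ t, ∑ a, ∑ b, P x a f * Q z f b := by
    intro f
    rw [Finset.sum_mul_sum]
    refine Finset.sum_congr rfl fun x _ => Finset.sum_congr rfl fun z _ => ?_
    rw [Finset.sum_mul_sum]
  simp_rw [h1]
  symm
  conv_lhs => rw [Finset.sum_comm]
  refine Finset.sum_congr rfl fun x _ => ?_
  conv_lhs => rw [Finset.sum_comm]
  refine Finset.sum_congr rfl fun z _ => ?_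
  conv_lhs => rw [Finset.sum_comm]
  refine Finset.sum_congr rfl fun a _ => ?_
  exact Finset.sum_comm

section Core

variable {P Q : (Fin D → ℤ) → (Fin D → ℤ) → F → F → ℝ} {BP BQ : ℝ}

/-- Summability of the Schur majorant `y ↦ Σ_f P(x,y,a,f)·Q(y,z,f,b)` from the column bound on `P` and the partial-sum bound on `Q`.
[folklore] -/
theorem summable_schur (hP0 : ∀ x y a f, 0 ≤ P x y a f) (hQ0 : ∀ y z f b, 0 ≤ Q y z f b)
    (hP : ∀ y f (s : Finset (Fin D → ℤ)), ∑ x ∈ s, ∑ a, P x y a f ≤ BP)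
    (hQ : ∀ u t : Finset (Fin D → ℤ), ∑ y ∈ u, ∑ z ∈ t, ∑ f, ∑ b, Q y z f b ≤ BQ) (x z : Fin D → ℤ) (a b : F) :
    Summable fun y => ∑ f, P x y a f * Q y z f b := by
  classical
  have hBP : 0 ≤ BP := by simpa using hP x a ∅
  have hPpt : ∀ y f, P x y a f ≤ BP := fun y f => by
    have h1 := hP y f {x}
    rw [Finset.sum_singleton] at h1
    exact le_trans (Finset.single_le_sum (f := fun a' => P x y a' f) (fun a' _ => hP0 x y a' f) (Finset.mem_univ a)) h1
  refine summable_of_sum_le (c := BP * BQ)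
    (fun y => Finset.sum_nonneg fun f _ => mul_nonneg (hP0 _ _ _ _) (hQ0 _ _ _ _)) fun u => ?_
  calc ∑ y ∈ u, ∑ f, P x y a f * Q y z f b ≤ ∑ y ∈ u, ∑ f, BP * ∑ b', Q y z f b' := by
        refine Finset.sum_le_sum fun y _ => Finset.sum_le_sum fun f _ => ?_
        exact mul_le_mul (hPpt y f)
          (Finset.single_le_sum (f := fun b' => Q y z f b') (fun b' _ => hQ0 _ _ _ _) (Finset.mem_univ b)) (hQ0 _ _ _ _) hBP
    _ = BP * ∑ y ∈ u, ∑ z' ∈ ({z} : Finset (Fin D → ℤ)), ∑ f, ∑ b', Q y z' f b' := by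
        rw [Finset.mul_sum]
        refine Finset.sum_congr rfl fun y _ => ?_
        rw [Finset.sum_singleton, Finset.mul_sum]
    _ ≤ BP * BQ := mul_le_mul_of_nonneg_left (hQ u {z}) hBP

/-- **SCHUR'S TEST, weighted bi-local form.**  If `|c x z a b|·w(x,z) ≤ Σ'_y Σ_f P(x,y,a,f)·Q(y,z,f,b)` termwise, the columns of
`P` are `≤ BP` (`0 ≤ BP`) and the `(y,z)`-partial sums of `Q` are `≤ BQ`, then every finite double sum of `|c|·w` is `≤ BP·BQ`.
[folklore] -/
theorem schur_bound (hP0 : ∀ x y a f, 0 ≤ P x y a f) (hQ0 : ∀ y z f b, 0 ≤ Q y z f b)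
    (hP : ∀ y f (s : Finset (Fin D → ℤ)), ∑ x ∈ s, ∑ a, P x y a f ≤ BP) (hBP : 0 ≤ BP)
    (hQ : ∀ u t : Finset (Fin D → ℤ), ∑ y ∈ u, ∑ z ∈ t, ∑ f, ∑ b, Q y z f b ≤ BQ)
    {c : MKer D F} {w : (Fin D → ℤ) → (Fin D → ℤ) → ℝ}
    (hdom : ∀ x z a b, |c x z a b| * w x z ≤ ∑' y, ∑ f, P x y a f * Q y z f b) (s t : Finset (Fin D → ℤ)) :
    ∑ x ∈ s, ∑ z ∈ t, ∑ a, ∑ b, |c x z a b| * w x z ≤ BP * BQ := by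
  classical
  -- the flattened index set
  have hflat : ∀ (g : (Fin D → ℤ) → (Fin D → ℤ) → F → F → ℝ),
      ∑ i ∈ (s ×ˢ t) ×ˢ ((Finset.univ : Finset F) ×ˢ (Finset.univ : Finset F)), g i.1.1 i.1.2 i.2.1 i.2.2 =
        ∑ x ∈ s, ∑ z ∈ t, ∑ a, ∑ b, g x z a b := fun g => by
    simp only [Finset.sum_product]
  have hre : ∀ y, ∑ x ∈ s, ∑ z ∈ t, ∑ a, ∑ b, ∑ f, P x y a f * Q y z f b =
      ∑ f, (∑ x ∈ s, ∑ a, P x y a f) * (∑ z ∈ t, ∑ b, Q y z f b) := fun y =>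
    sum_reorder s t (fun x a f => P x y a f) (fun z f b => Q y z f b)
  have hM : ∀ u : Finset (Fin D → ℤ), ∑ y ∈ u, ∑ i ∈ (s ×ˢ t) ×ˢ ((Finset.univ : Finset F) ×ˢ (Finset.univ : Finset F)),
      (∑ f, P i.1.1 y i.2.1 f * Q y i.1.2 f i.2.2) ≤ BP * BQ := by
    intro u
    have hy : ∀ y, ∑ i ∈ (s ×ˢ t) ×ˢ ((Finset.univ : Finset F) ×ˢ (Finset.univ : Finset F)),
        (∑ f, P i.1.1 y i.2.1 f * Q y i.1.2 f i.2.2) ≤ BP * ∑ z ∈ t, ∑ f, ∑ b, Q y z f b := by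
      intro y
      rw [hflat (fun x z a b => ∑ f, P x y a f * Q y z f b), hre y]
      calc ∑ f, (∑ x ∈ s, ∑ a, P x y a f) * (∑ z ∈ t, ∑ b, Q y z f b)
          ≤ ∑ f, BP * (∑ z ∈ t, ∑ b, Q y z f b) := Finset.sum_le_sum fun f _ =>
            mul_le_mul_of_nonneg_right (hP y f s) (Finset.sum_nonneg fun z _ => Finset.sum_nonneg fun b _ => hQ0 _ _ _ _)
        _ = BP * ∑ z ∈ t, ∑ f, ∑ b, Q y z f b := by rw [← Finset.mul_sum, Finset.sum_comm]
    calc ∑ y ∈ u, ∑ i ∈ (s ×ˢ t) ×ˢ ((Finset.univ : Finset F) ×ˢ (Finset.univ : Finset F)),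
          (∑ f, P i.1.1 y i.2.1 f * Q y i.1.2 f i.2.2)
        ≤ ∑ y ∈ u, BP * ∑ z ∈ t, ∑ f, ∑ b, Q y z f b := Finset.sum_le_sum fun y _ => hy y
      _ = BP * ∑ y ∈ u, ∑ z ∈ t, ∑ f, ∑ b, Q y z f b := by rw [Finset.mul_sum]
      _ ≤ BP * BQ := mul_le_mul_of_nonneg_left (hQ u t) hBP
  have key := (sum_tsum_le ((s ×ˢ t) ×ˢ ((Finset.univ : Finset F) ×ˢ (Finset.univ : Finset F)))
    (m := fun i y => ∑ f, P i.1.1 y i.2.1 f * Q y i.1.2 f i.2.2)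
    (fun i y => Finset.sum_nonneg fun f _ => mul_nonneg (hP0 _ _ _ _) (hQ0 _ _ _ _)) hM).2
  calc ∑ x ∈ s, ∑ z ∈ t, ∑ a, ∑ b, |c x z a b| * w x z
      ≤ ∑ x ∈ s, ∑ z ∈ t, ∑ a, ∑ b, ∑' y, ∑ f, P x y a f * Q y z f b :=
        Finset.sum_le_sum fun x _ => Finset.sum_le_sum fun z _ => Finset.sum_le_sum fun a _ =>
          Finset.sum_le_sum fun b _ => hdom x z a b
    _ = ∑ i ∈ (s ×ˢ t) ×ˢ ((Finset.univ : Finset F) ×ˢ (Finset.univ : Finset F)),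
          ∑' y, ∑ f, P i.1.1 y i.2.1 f * Q y i.1.2 f i.2.2 :=
        (hflat (fun x z a b => ∑' y, ∑ f, P x y a f * Q y z f b)).symm
    _ ≤ BP * BQ := key

end Core

/-- Domination of a composition entry by a summable majorant, with a weight: if `|Σ_f A(x,y,a,f)K(y,z,f,b)|·w ≤ m y` for all `y`,
then `|(A∘K)(x,z,a,b)|·w ≤ Σ'_y m y`. [folklore] -/
theorem abs_comp_mul_le {A K : MKer D F} {x z : Fin D → ℤ} {a b : F} {w : ℝ} (hw : 0 < w) {m : (Fin D → ℤ) → ℝ}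
    (hm : Summable m) (h : ∀ y, |∑ f, A x y a f * K y z f b| * w ≤ m y) : |comp A K x z a b| * w ≤ ∑' y, m y := by
  have h' : ∀ y, ‖∑ f, A x y a f * K y z f b‖ ≤ m y / w := fun y => by
    rw [Real.norm_eq_abs, le_div_iff₀ hw]; exact h y
  have hb := tsum_of_norm_bounded (hm.hasSum.div_const w) h'
  rw [Real.norm_eq_abs] at hb
  unfold ExpKernelCalculus.comp
  exact (le_div_iff₀ hw).mp hb

/-- The fibre-sum estimate `|Σ_f A K| ≤ Σ_f |A|·|K|`. [folklore] -/
theorem abs_fibreSum_le (A K : MKer D F) (x y z : Fin D → ℤ) (a b : F) :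
    |∑ f, A x y a f * K y z f b| ≤ ∑ f, |A x y a f| * |K y z f b| :=
  (Finset.abs_sum_le_sum_abs _ _).trans (le_of_eq (Finset.sum_congr rfl fun _ _ => abs_mul _ _))

/-- **WEIGHTED COLUMNS ∘ WEIGHTED BI-LOCALISED IS WEIGHTED BI-LOCALISED — same rate, constant `B_A·B_V`, no lattice constant.**
[folklore] -/
theorem biW_comp_colW {A V : MKer D F} {p q : Fin D → ℤ} {R BA BV : ℝ} (hA : ColW A R BA) (hV : BiW V p q R BV)
    (hR : 0 ≤ R) : BiW (comp A V) p q R (BA * BV) := by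
  classical
  have hP0 : ∀ (x y : Fin D → ℤ) (a f : F), 0 ≤ |A x y a f| * Real.exp (R * l1 (x - y)) := fun _ _ _ _ => by positivity
  have hQ0 : ∀ (y z : Fin D → ℤ) (f b : F), 0 ≤ |V y z f b| * Real.exp (R * (l1 (y - p) + l1 (z - q))) :=
    fun _ _ _ _ => by positivity
  intro s t
  refine schur_bound (P := fun x y a f => |A x y a f| * Real.exp (R * l1 (x - y)))
    (Q := fun y z f b => |V y z f b| * Real.exp (R * (l1 (y - p) + l1 (z - q)))) hP0 hQ0
    (fun y f s' => hA.2 y f s') hA.nonneg (fun u t' => hV u t') (c := comp A V)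
    (w := fun x z => Real.exp (R * (l1 (x - p) + l1 (z - q)))) (fun x z a b => ?_) s t
  refine abs_comp_mul_le (Real.exp_pos _)
    (summable_schur (P := fun x y a f => |A x y a f| * Real.exp (R * l1 (x - y)))
      (Q := fun y z f b => |V y z f b| * Real.exp (R * (l1 (y - p) + l1 (z - q)))) hP0 hQ0
      (fun y f s' => hA.2 y f s') (fun u t' => hV u t') x z a b) fun y => ?_
  have hexp : Real.exp (R * (l1 (x - p) + l1 (z - q))) ≤
      Real.exp (R * l1 (x - y)) * Real.exp (R * (l1 (y - p) + l1 (z - q))) := by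
    rw [← Real.exp_add, Real.exp_le_exp]
    have := mul_le_mul_of_nonneg_left (l1_sub_triangle x y p) hR
    linarith
  calc |∑ f, A x y a f * V y z f b| * Real.exp (R * (l1 (x - p) + l1 (z - q)))
      ≤ (∑ f, |A x y a f| * |V y z f b|) * (Real.exp (R * l1 (x - y)) * Real.exp (R * (l1 (y - p) + l1 (z - q)))) :=
        mul_le_mul (abs_fibreSum_le A V x y z a b) hexp (Real.exp_pos _).le (Finset.sum_nonneg fun f _ => by positivity)
    _ = ∑ f, |A x y a f| * Real.exp (R * l1 (x - y)) * (|V y z f b| * Real.exp (R * (l1 (y - p) + l1 (z - q)))) := by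
        rw [Finset.sum_mul]
        exact Finset.sum_congr rfl fun f _ => by ring

/-- **WEIGHTED BI-LOCALISED ∘ WEIGHTED BI-LOCALISED** (`X` at `(p, p′)`, `Y` at `(q′, q)`): `X∘Y` is `BiW` at `(p, q)` with constant
`B_X·B_Y·e^{−R|p′−q′|₁}` — a GAIN of the separation of the inner points. [folklore] -/
theorem biW_comp_biW {X Y : MKer D F} {p p' q' q : Fin D → ℤ} {R BX BY : ℝ} (hX : BiW X p p' R BX) (hY : BiW Y q' q R BY)
    (hR : 0 ≤ R) : BiW (comp X Y) p q R (BX * BY * Real.exp (-R * l1 (p' - q'))) := by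
  classical
  have hP0 : ∀ (x y : Fin D → ℤ) (a f : F), 0 ≤ |X x y a f| * Real.exp (R * (l1 (x - p) + l1 (y - p'))) :=
    fun _ _ _ _ => by positivity
  have hQ0 : ∀ (y z : Fin D → ℤ) (f b : F),
      0 ≤ |Y y z f b| * Real.exp (R * (l1 (y - q') + l1 (z - q))) * Real.exp (-R * l1 (p' - q')) :=
    fun _ _ _ _ => by positivity
  have hP : ∀ y f (s : Finset (Fin D → ℤ)), ∑ x ∈ s, ∑ a, |X x y a f| * Real.exp (R * (l1 (x - p) + l1 (y - p'))) ≤ BX := by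
    intro y f s
    have h1 := hX s {y}
    refine le_trans (Finset.sum_le_sum fun x _ => ?_) h1
    rw [Finset.sum_singleton]
    exact Finset.sum_le_sum fun a _ => Finset.single_le_sum
      (f := fun f' => |X x y a f'| * Real.exp (R * (l1 (x - p) + l1 (y - p')))) (fun f' _ => by positivity) (Finset.mem_univ f)
  have hQ : ∀ u t : Finset (Fin D → ℤ), ∑ y ∈ u, ∑ z ∈ t, ∑ f, ∑ b,
      |Y y z f b| * Real.exp (R * (l1 (y - q') + l1 (z - q))) * Real.exp (-R * l1 (p' - q')) ≤
        BY * Real.exp (-R * l1 (p' - q')) := by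
    intro u t
    rw [show (∑ y ∈ u, ∑ z ∈ t, ∑ f, ∑ b,
        |Y y z f b| * Real.exp (R * (l1 (y - q') + l1 (z - q))) * Real.exp (-R * l1 (p' - q'))) =
        (∑ y ∈ u, ∑ z ∈ t, ∑ f, ∑ b, |Y y z f b| * Real.exp (R * (l1 (y - q') + l1 (z - q)))) *
          Real.exp (-R * l1 (p' - q')) by simp only [Finset.sum_mul]]
    exact mul_le_mul_of_nonneg_right (hY u t) (Real.exp_pos _).le
  intro s t
  rw [show BX * BY * Real.exp (-R * l1 (p' - q')) = BX * (BY * Real.exp (-R * l1 (p' - q'))) by ring]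
  refine schur_bound (P := fun x y a f => |X x y a f| * Real.exp (R * (l1 (x - p) + l1 (y - p'))))
    (Q := fun y z f b => |Y y z f b| * Real.exp (R * (l1 (y - q') + l1 (z - q))) * Real.exp (-R * l1 (p' - q')))
    hP0 hQ0 hP hX.nonneg hQ (c := comp X Y) (w := fun x z => Real.exp (R * (l1 (x - p) + l1 (z - q)))) (fun x z a b => ?_) s t
  refine abs_comp_mul_le (Real.exp_pos _)
    (summable_schur (P := fun x y a f => |X x y a f| * Real.exp (R * (l1 (x - p) + l1 (y - p'))))
      (Q := fun y z f b => |Y y z f b| * Real.exp (R * (l1 (y - q') + l1 (z - q))) * Real.exp (-R * l1 (p' - q')))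
      hP0 hQ0 hP hQ x z a b) fun y => ?_
  have hexp : Real.exp (R * (l1 (x - p) + l1 (z - q))) ≤
      Real.exp (R * (l1 (x - p) + l1 (y - p'))) * (Real.exp (R * (l1 (y - q') + l1 (z - q))) *
        Real.exp (-R * l1 (p' - q'))) := by
    rw [← Real.exp_add, ← Real.exp_add, Real.exp_le_exp]
    have ht : l1 (p' - q') ≤ l1 (p' - y) + l1 (y - q') := l1_sub_triangle p' y q'
    rw [l1_sub_symm p' y] at ht
    have := mul_le_mul_of_nonneg_left ht hR
    linarith
  calc |∑ f, X x y a f * Y y z f b| * Real.exp (R * (l1 (x - p) + l1 (z - q)))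
      ≤ (∑ f, |X x y a f| * |Y y z f b|) * (Real.exp (R * (l1 (x - p) + l1 (y - p'))) *
          (Real.exp (R * (l1 (y - q') + l1 (z - q))) * Real.exp (-R * l1 (p' - q')))) :=
        mul_le_mul (abs_fibreSum_le X Y x y z a b) hexp (Real.exp_pos _).le (Finset.sum_nonneg fun f _ => by positivity)
    _ = ∑ f, |X x y a f| * Real.exp (R * (l1 (x - p) + l1 (y - p'))) *
          (|Y y z f b| * Real.exp (R * (l1 (y - q') + l1 (z - q))) * Real.exp (-R * l1 (p' - q'))) := by
        rw [Finset.sum_mul]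
        exact Finset.sum_congr rfl fun f _ => by ring

/-- The diagonal of a weighted bi-localised kernel: `x ↦ Σ_a |K x x a a|·e^{R(|x−p|₁+|x−q|₁)}` is summable with sum `≤ B`. [folklore] -/
theorem summable_diag_of_biW {K : MKer D F} {p q : Fin D → ℤ} {R B : ℝ} (hK : BiW K p q R B) :
    (Summable fun x => ∑ a, |K x x a a| * Real.exp (R * (l1 (x - p) + l1 (x - q)))) ∧
      ∑' x, ∑ a, |K x x a a| * Real.exp (R * (l1 (x - p) + l1 (x - q))) ≤ B := by
  classical
  have h0 : ∀ x, 0 ≤ ∑ a, |K x x a a| * Real.exp (R * (l1 (x - p) + l1 (x - q))) :=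
    fun x => Finset.sum_nonneg fun a _ => by positivity
  have hpart : ∀ s : Finset (Fin D → ℤ), ∑ x ∈ s, ∑ a, |K x x a a| * Real.exp (R * (l1 (x - p) + l1 (x - q))) ≤ B := by
    intro s
    refine le_trans (Finset.sum_le_sum fun x hx => ?_) (hK s s)
    calc ∑ a, |K x x a a| * Real.exp (R * (l1 (x - p) + l1 (x - q)))
        ≤ ∑ a, ∑ b, |K x x a b| * Real.exp (R * (l1 (x - p) + l1 (x - q))) := Finset.sum_le_sum fun a _ =>
          Finset.single_le_sum (f := fun b => |K x x a b| * Real.exp (R * (l1 (x - p) + l1 (x - q))))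
            (fun b _ => by positivity) (Finset.mem_univ a)
      _ ≤ ∑ y ∈ s, ∑ a, ∑ b, |K x y a b| * Real.exp (R * (l1 (x - p) + l1 (y - q))) :=
          Finset.single_le_sum (f := fun y => ∑ a, ∑ b, |K x y a b| * Real.exp (R * (l1 (x - p) + l1 (y - q))))
            (fun y _ => Finset.sum_nonneg fun a _ => Finset.sum_nonneg fun b _ => by positivity) hx
  have hs : Summable fun x => ∑ a, |K x x a a| * Real.exp (R * (l1 (x - p) + l1 (x - q))) :=
    summable_of_sum_le (fun x => h0 x) hpart
  exact ⟨hs, hs.tsum_le_of_sum_le hpart⟩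

/-- **THE TRACE OF A WEIGHTED BI-LOCALISED KERNEL**: the trace series converges absolutely and `|tr K| ≤ B·e^{−R|p−q|₁}` — the full
separation is GAINED and no lattice constant appears (compare `ExpKernelCalculus.abs_tr_le`: `|F|·C·Zl(δ/2)·e^{−(δ/2)|p−q|₁}`).
[folklore] -/
theorem abs_tr_le_biW {K : MKer D F} {p q : Fin D → ℤ} {R B : ℝ} (hK : BiW K p q R B) (hR : 0 ≤ R) :
    (Summable fun x => ∑ a, K x x a a) ∧ |tr K| ≤ B * Real.exp (-R * l1 (p - q)) := by
  classical
  obtain ⟨hs, hle⟩ := summable_diag_of_biW hK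
  set e : ℝ := Real.exp (-R * l1 (p - q)) with he
  have hterm : ∀ x, ‖∑ a, K x x a a‖ ≤ (∑ a, |K x x a a| * Real.exp (R * (l1 (x - p) + l1 (x - q)))) * e := by
    intro x
    rw [Real.norm_eq_abs]
    have hw : 1 ≤ Real.exp (R * (l1 (x - p) + l1 (x - q))) * e := by
      rw [he, ← Real.exp_add, Real.one_le_exp_iff]
      have ht : l1 (p - q) ≤ l1 (p - x) + l1 (x - q) := l1_sub_triangle p x q
      rw [l1_sub_symm p x] at ht
      have := mul_le_mul_of_nonneg_left ht hR
      linarith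
    calc |∑ a, K x x a a| ≤ ∑ a, |K x x a a| := Finset.abs_sum_le_sum_abs _ _
      _ ≤ ∑ a, |K x x a a| * (Real.exp (R * (l1 (x - p) + l1 (x - q))) * e) :=
          Finset.sum_le_sum fun a _ => le_mul_of_one_le_right (abs_nonneg _) hw
      _ = (∑ a, |K x x a a| * Real.exp (R * (l1 (x - p) + l1 (x - q)))) * e := by
          rw [Finset.sum_mul]; exact Finset.sum_congr rfl fun a _ => by ring
  refine ⟨Summable.of_norm_bounded (hs.mul_right e) hterm, ?_⟩
  have hb := tsum_of_norm_bounded (hs.hasSum.mul_right e) hterm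
  rw [Real.norm_eq_abs] at hb
  unfold ExpKernelCalculus.tr
  refine hb.trans ?_
  exact mul_le_mul_of_nonneg_right hle (Real.exp_pos _).le

/-- **TADPOLE BOUND, weighted**: `ColW A R B_A`, `BiW W₂ p q R B_W` ⟹ `|tadpole A W₂| ≤ B_A·B_W·e^{−R|p−q|₁}`. [folklore] -/
theorem abs_tadpole_le_W {A W₂ : MKer D F} {p q : Fin D → ℤ} {R BA BW : ℝ} (hA : ColW A R BA) (hW : BiW W₂ p q R BW)
    (hR : 0 ≤ R) : |tadpole A W₂| ≤ BA * BW * Real.exp (-R * l1 (p - q)) := by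
  unfold ExpKernelCalculus.tadpole
  exact (abs_tr_le_biW (biW_comp_colW hA hW hR) hR).2

/-- **BUBBLE BOUND, weighted**: `ColW A R B_A`, `BiW V p p R B_V`, `BiW W q q R B_W` ⟹
`|bubble A V W| ≤ B_A B_V·(B_A B_W)·e^{−R|p−q|₁}·e^{−R|p−q|₁}` (rate `2R` in the separation; no lattice constant). [folklore] -/
theorem abs_bubble_le_W {A V W : MKer D F} {p q : Fin D → ℤ} {R BA BV BW : ℝ} (hA : ColW A R BA) (hV : BiW V p p R BV)
    (hW : BiW W q q R BW) (hR : 0 ≤ R) :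
    |bubble A V W| ≤ BA * BV * (BA * BW) * Real.exp (-R * l1 (p - q)) * Real.exp (-R * l1 (p - q)) := by
  unfold ExpKernelCalculus.bubble
  exact (abs_tr_le_biW (biW_comp_biW (biW_comp_colW hA hV hR) (biW_comp_colW hA hW hR) hR) hR).2

/-! ## §3 The (5.10)-decay of `hessKer` at rate `R·N` -/

/-- THE EXPLICIT (5.10)-CONSTANT in the weighted classes: `½·B_A B_W + ½·(B_A B_V)²`. [folklore] -/
def hessW (BA BV BW : ℝ) : ℝ := 1 / 2 * (BA * BW) + 1 / 2 * (BA * BV * (BA * BV))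

/-- The distance of the localisation points `0` and `N • z`: `|0 − N•z|₁ = N·|z|₁`. [folklore] -/
theorem l1_zero_sub_natSmul (N : ℕ) (z : Fin D → ℤ) : l1 ((0 : Fin D → ℤ) - (N : ℤ) • z) = (N : ℝ) * l1 z := by
  rw [l1_sub_symm, sub_zero, l1_natSmul]

/-- **(5.10)-SHAPE DECAY OF THE RESOLVENT HESSIAN KERNEL AT RATE `R·N`**: `ColW A R B_A`, `VertexFamilyW V N R B_V`,
`VertexFamily₂W W N R B_W`, `0 ≤ R` ⟹ `|hessKer A V W μ ν z| ≤ hessW(B_A,B_V,B_W)·e^{−(R·N)|z|₁}` — the decay length is the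
constituents' `R` times the blocking `N` (the vertices sit at the coarse points `N • z`), against `δ/4` in
`ExpKernelCalculus.decay510_hessKer`. [folklore] -/
theorem decay510_hessKer_W {A : MKer D F} {V : Fin D → (Fin D → ℤ) → MKer D F}
    {W : Fin D → (Fin D → ℤ) → Fin D → (Fin D → ℤ) → MKer D F} {R BA BV BW : ℝ} {N : ℕ}
    (hA : ColW A R BA) (hV : VertexFamilyW V N R BV) (hW : VertexFamily₂W W N R BW) (hR : 0 ≤ R) (μ ν : Fin D) :
    Decay510 (hessKer A V W μ ν) (hessW BA BV BW) (R * N) := by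
  intro z
  have hW0 : BiW (W μ 0 ν z) 0 ((N : ℤ) • z) R BW := by simpa using hW μ 0 ν z
  have hV0 : BiW (V μ 0) 0 0 R BV := by simpa using hV μ 0
  have ht := abs_tadpole_le_W hA hW0 hR
  have hb := abs_bubble_le_W hA hV0 (hV ν z) hR
  rw [l1_zero_sub_natSmul] at ht hb
  have he : Real.exp (-R * ((N : ℝ) * l1 z)) = Real.exp (-(R * N) * l1 z) := by congr 1; ring
  rw [he] at ht hb
  set e := Real.exp (-(R * N) * l1 z) with hedef
  have he0 : 0 ≤ e := (Real.exp_pos _).le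
  have he1 : e ≤ 1 := by
    rw [hedef, Real.exp_le_one_iff]
    have : 0 ≤ R * (N : ℝ) * l1 z := by have := l1_nonneg z; positivity
    linarith
  have hsq : 0 ≤ BA * BV * (BA * BV) := mul_self_nonneg _
  show |1 / 2 * tadpole A (W μ 0 ν z) - 1 / 2 * bubble A (V μ 0) (V ν z)| ≤ hessW BA BV BW * e
  calc |1 / 2 * tadpole A (W μ 0 ν z) - 1 / 2 * bubble A (V μ 0) (V ν z)|
      ≤ |1 / 2 * tadpole A (W μ 0 ν z)| + |1 / 2 * bubble A (V μ 0) (V ν z)| := abs_sub _ _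
    _ = 1 / 2 * |tadpole A (W μ 0 ν z)| + 1 / 2 * |bubble A (V μ 0) (V ν z)| := by
        rw [abs_mul, abs_mul, abs_of_pos (by norm_num : (0:ℝ) < 1 / 2)]
    _ ≤ 1 / 2 * (BA * BW * e) + 1 / 2 * (BA * BV * (BA * BV) * e * e) := by gcongr
    _ ≤ 1 / 2 * (BA * BW * e) + 1 / 2 * (BA * BV * (BA * BV) * e) := by
        have : BA * BV * (BA * BV) * e * e ≤ BA * BV * (BA * BV) * e * 1 :=
          mul_le_mul_of_nonneg_left he1 (mul_nonneg hsq he0)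
        linarith
    _ = hessW BA BV BW * e := by unfold hessW; ring

/-- … hence absolutely summable second moments (`AbsMoment₂`) for `0 < R`, `1 ≤ N` — the (T-def) slot is well-typed in the weighted
classes too. [folklore] -/
theorem absMoment₂_hessKer_W {A : MKer D F} {V : Fin D → (Fin D → ℤ) → MKer D F}
    {W : Fin D → (Fin D → ℤ) → Fin D → (Fin D → ℤ) → MKer D F} {R BA BV BW : ℝ} {N : ℕ}
    (hA : ColW A R BA) (hV : VertexFamilyW V N R BV) (hW : VertexFamily₂W W N R BW) (hR : 0 < R) (hN : 1 ≤ N) (μ ν : Fin D) :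
    DecimatedMomentSummable.AbsMoment₂ (hessKer A V W μ ν) :=
  DecimatedMomentSummable.absMoment₂_of_decay510
    (mul_pos hR (by exact_mod_cast (show 0 < N by omega))) (decay510_hessKer_W hA hV hW hR.le μ ν)

/-! ## §4 The Lipschitz twin at rate `R·N` -/

/-- **THE LIPSCHITZ CONSTANT OF `hessKer` in the weighted classes** — LINEAR in the deviations `εA, εV, εW`; arguments: the column
bounds `B_A` (live) / `B_A′` (reference), the first-order vertex bounds `B_V` / `B_V′`, the second-order bound `B_W`. [folklore] -/
def lipW (BA BA' BV BV' BW εA εV εW : ℝ) : ℝ :=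
  1 / 2 * (εA * BW + BA' * εW) + 1 / 2 * ((εA * BV + BA' * εV) * (BA * BV) + BA' * BV' * (εA * BV + BA' * εV))

/-- `lipW` is LINEAR in the deviations. [folklore] -/
theorem lipW_mul (BA BA' BV BV' BW εA εV εW t : ℝ) :
    lipW BA BA' BV BV' BW (εA * t) (εV * t) (εW * t) = lipW BA BA' BV BV' BW εA εV εW * t := by
  unfold lipW; ring

/-- At zero reference `lipW` IS `hessW`. [folklore] -/
theorem lipW_zero_ref (BA BV BW : ℝ) : lipW BA 0 BV 0 BW BA BV BW = hessW BA BV BW := by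
  unfold lipW hessW; ring

/-- `lipW` is nonnegative on nonnegative data. [folklore] -/
theorem lipW_nonneg {BA BA' BV BV' BW εA εV εW : ℝ} (hBA : 0 ≤ BA) (hBA' : 0 ≤ BA') (hBV : 0 ≤ BV) (hBV' : 0 ≤ BV')
    (hBW : 0 ≤ BW) (hεA : 0 ≤ εA) (hεV : 0 ≤ εV) (hεW : 0 ≤ εW) : 0 ≤ lipW BA BA' BV BV' BW εA εV εW := by
  unfold lipW; positivity

/-- **THE RESOLVENT HESSIAN KERNEL IS LIPSCHITZ IN `(A, V, W)` AT RATE `R·N`**: with live data `ColW A R B_A`, `VertexFamilyW V N R B_V`,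
`VertexFamily₂W W N R B_W`, reference data `(A′, V′, W′)` in the same classes, and deviations `ColW (A − A′) R εA`,
`VertexFamilyW (V − V′) N R εV`, `VertexFamily₂W (W − W′) N R εW` (`0 < R`):
`|hessKer A V W μ ν z − hessKer A′ V′ W′ μ ν z| ≤ lipW(…, εA, εV, εW)·e^{−(R·N)|z|₁}`. [folklore] -/
theorem decay510_hessKer_sub_W {A A' : MKer D F} {V V' : Fin D → (Fin D → ℤ) → MKer D F}
    {W W' : Fin D → (Fin D → ℤ) → Fin D → (Fin D → ℤ) → MKer D F} {R BA BA' BV BV' BW BW' εA εV εW : ℝ} {N : ℕ}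
    (hA : ColW A R BA) (hA' : ColW A' R BA') (hAA : ColW (A - A') R εA)
    (hV : VertexFamilyW V N R BV) (hV' : VertexFamilyW V' N R BV') (hVV : VertexFamilyW (V - V') N R εV)
    (hW : VertexFamily₂W W N R BW) (hW' : VertexFamily₂W W' N R BW') (hWW : VertexFamily₂W (W - W') N R εW)
    (hR : 0 < R) (μ ν : Fin D) :
    Decay510 (fun z => hessKer A V W μ ν z - hessKer A' V' W' μ ν z) (lipW BA BA' BV BV' BW εA εV εW) (R * N) := by
  intro z
  have hR0 := hR.le
  -- the localised data at `0` and `N • z`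
  have hW0 : BiW (W μ 0 ν z) 0 ((N : ℤ) • z) R BW := by simpa using hW μ 0 ν z
  have hW0' : BiW (W' μ 0 ν z) 0 ((N : ℤ) • z) R BW' := by simpa using hW' μ 0 ν z
  have hWW0 : BiW (W μ 0 ν z - W' μ 0 ν z) 0 ((N : ℤ) • z) R εW := by simpa using hWW μ 0 ν z
  have hV0 : BiW (V μ 0) 0 0 R BV := by simpa using hV μ 0
  have hV0' : BiW (V' μ 0) 0 0 R BV' := by simpa using hV' μ 0
  have hVV0 : BiW (V μ 0 - V' μ 0) 0 0 R εV := by simpa using hVV μ 0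
  have hVz := hV ν z
  have hVz' := hV' ν z
  have hVVz : BiW (V ν z - V' ν z) ((N : ℤ) • z) ((N : ℤ) • z) R εV := hVV ν z
  -- signs
  have hBA := hA.nonneg
  have hBA' := hA'.nonneg
  have hεA := hAA.nonneg
  have hBV := hV0.nonneg
  have hBV' := hV0'.nonneg
  have hεV := hVV0.nonneg
  have hBW := hW0.nonneg
  have hεW := hWW0.nonneg
  -- TADPOLE channel: `tadpole A W₂ − tadpole A′ W₂′ = tr ((A−A′)∘W₂ + A′∘(W₂−W₂′))`
  have hT : |tadpole A (W μ 0 ν z) - tadpole A' (W' μ 0 ν z)| ≤ (εA * BW + BA' * εW) * Real.exp (-R * l1 ((0 : Fin D → ℤ) - (N : ℤ) • z)) := by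
    rw [tadpole_sub_tadpole hA.decays hA'.decays hW0.biLoc hW0'.biLoc hR,
      comp_sub_comp hA.decays hA'.decays hW0.biLoc hW0'.biLoc hR]
    exact (abs_tr_le_biW ((biW_comp_colW hAA hW0 hR0).add (biW_comp_colW hA' hWW0 hR0)) hR0).2
  -- BUBBLE channel: `X = A∘V₀`, `Y = A∘V_z` and their references
  have hX := biW_comp_colW hA hV0 hR0
  have hX' := biW_comp_colW hA' hV0' hR0
  have hY := biW_comp_colW hA hVz hR0
  have hY' := biW_comp_colW hA' hVz' hR0
  have hXX : BiW (comp A (V μ 0) - comp A' (V' μ 0)) 0 0 R (εA * BV + BA' * εV) := by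
    rw [comp_sub_comp hA.decays hA'.decays hV0.biLoc hV0'.biLoc hR]
    exact (biW_comp_colW hAA hV0 hR0).add (biW_comp_colW hA' hVV0 hR0)
  have hYY : BiW (comp A (V ν z) - comp A' (V' ν z)) ((N : ℤ) • z) ((N : ℤ) • z) R (εA * BV + BA' * εV) := by
    rw [comp_sub_comp hA.decays hA'.decays hVz.biLoc hVz'.biLoc hR]
    exact (biW_comp_colW hAA hVz hR0).add (biW_comp_colW hA' hVVz hR0)
  have hB : |bubble A (V μ 0) (V ν z) - bubble A' (V' μ 0) (V' ν z)| ≤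
      ((εA * BV + BA' * εV) * (BA * BV) * Real.exp (-R * l1 ((0 : Fin D → ℤ) - (N : ℤ) • z)) +
        BA' * BV' * (εA * BV + BA' * εV) * Real.exp (-R * l1 ((0 : Fin D → ℤ) - (N : ℤ) • z))) *
        Real.exp (-R * l1 ((0 : Fin D → ℤ) - (N : ℤ) • z)) := by
    rw [bubble_sub_bubble hA.decays hA'.decays hV0.biLoc hV0'.biLoc hVz.biLoc hVz'.biLoc hR,
      comp_sub_comp_bb hX.biLoc hX'.biLoc hY.biLoc hY'.biLoc hR]
    exact (abs_tr_le_biW ((biW_comp_biW hXX hY hR0).add (biW_comp_biW hX' hYY hR0)) hR0).2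
  -- rates: `|0 − N•z|₁ = N|z|₁`
  rw [l1_zero_sub_natSmul] at hT hB
  have he : Real.exp (-R * ((N : ℝ) * l1 z)) = Real.exp (-(R * N) * l1 z) := by congr 1; ring
  rw [he] at hT hB
  set e := Real.exp (-(R * N) * l1 z) with hedef
  have he0 : 0 ≤ e := (Real.exp_pos _).le
  have he1 : e ≤ 1 := by
    rw [hedef, Real.exp_le_one_iff]
    have : 0 ≤ R * (N : ℝ) * l1 z := by have := l1_nonneg z; positivity
    linarith
  have hcoef : 0 ≤ (εA * BV + BA' * εV) * (BA * BV) + BA' * BV' * (εA * BV + BA' * εV) := by positivity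
  have hB' : |bubble A (V μ 0) (V ν z) - bubble A' (V' μ 0) (V' ν z)| ≤
      ((εA * BV + BA' * εV) * (BA * BV) + BA' * BV' * (εA * BV + BA' * εV)) * e := by
    refine hB.trans ?_
    have : ((εA * BV + BA' * εV) * (BA * BV) * e + BA' * BV' * (εA * BV + BA' * εV) * e) * e =
        ((εA * BV + BA' * εV) * (BA * BV) + BA' * BV' * (εA * BV + BA' * εV)) * e * e := by ring
    rw [this]
    calc ((εA * BV + BA' * εV) * (BA * BV) + BA' * BV' * (εA * BV + BA' * εV)) * e * e
        ≤ ((εA * BV + BA' * εV) * (BA * BV) + BA' * BV' * (εA * BV + BA' * εV)) * e * 1 :=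
          mul_le_mul_of_nonneg_left he1 (mul_nonneg hcoef he0)
      _ = _ := by ring
  show |(1 / 2 * tadpole A (W μ 0 ν z) - 1 / 2 * bubble A (V μ 0) (V ν z)) -
      (1 / 2 * tadpole A' (W' μ 0 ν z) - 1 / 2 * bubble A' (V' μ 0) (V' ν z))| ≤ lipW BA BA' BV BV' BW εA εV εW * e
  rw [show (1 / 2 * tadpole A (W μ 0 ν z) - 1 / 2 * bubble A (V μ 0) (V ν z)) -
      (1 / 2 * tadpole A' (W' μ 0 ν z) - 1 / 2 * bubble A' (V' μ 0) (V' ν z)) =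
      1 / 2 * (tadpole A (W μ 0 ν z) - tadpole A' (W' μ 0 ν z)) -
        1 / 2 * (bubble A (V μ 0) (V ν z) - bubble A' (V' μ 0) (V' ν z)) by ring]
  calc |1 / 2 * (tadpole A (W μ 0 ν z) - tadpole A' (W' μ 0 ν z)) -
        1 / 2 * (bubble A (V μ 0) (V ν z) - bubble A' (V' μ 0) (V' ν z))|
      ≤ |1 / 2 * (tadpole A (W μ 0 ν z) - tadpole A' (W' μ 0 ν z))| +
          |1 / 2 * (bubble A (V μ 0) (V ν z) - bubble A' (V' μ 0) (V' ν z))| := abs_sub _ _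
    _ = 1 / 2 * |tadpole A (W μ 0 ν z) - tadpole A' (W' μ 0 ν z)| +
          1 / 2 * |bubble A (V μ 0) (V ν z) - bubble A' (V' μ 0) (V' ν z)| := by
        rw [abs_mul, abs_mul, abs_of_pos (by norm_num : (0:ℝ) < 1 / 2)]
    _ ≤ 1 / 2 * ((εA * BW + BA' * εW) * e) +
          1 / 2 * (((εA * BV + BA' * εV) * (BA * BV) + BA' * BV' * (εA * BV + BA' * εV)) * e) := by gcongr
    _ = lipW BA BA' BV BV' BW εA εV εW * e := by unfold lipW; ring

/-- The explicit-constant (5.10) bound as the special case `A′ = 0`, `V′ = 0`, `W′ = 0` of the Lipschitz bound is `decay510_hessKer_W`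
itself (`lipW_zero_ref`); recorded for the record. [folklore] -/
theorem decay510_hessKer_W' {A : MKer D F} {V : Fin D → (Fin D → ℤ) → MKer D F}
    {W : Fin D → (Fin D → ℤ) → Fin D → (Fin D → ℤ) → MKer D F} {R BA BV BW : ℝ} {N : ℕ}
    (hA : ColW A R BA) (hV : VertexFamilyW V N R BV) (hW : VertexFamily₂W W N R BW) (hR : 0 ≤ R) (μ ν : Fin D) :
    Decay510 (hessKer A V W μ ν) (lipW BA 0 BV 0 BW BA BV BW) (R * N) := by
  rw [lipW_zero_ref]; exact decay510_hessKer_W hA hV hW hR μ ν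

/-! ## §5 Rates: uniformly bounded, geometrically convergent ingredients ⟹ `GeomRate` of the moments, constant at rate `R·N` -/

section Rate

variable {A : ℕ → MKer D F} {Ainf : MKer D F} {V : ℕ → Fin D → (Fin D → ℤ) → MKer D F}
  {Vinf : Fin D → (Fin D → ℤ) → MKer D F} {W : ℕ → Fin D → (Fin D → ℤ) → Fin D → (Fin D → ℤ) → MKer D F}
  {Winf : Fin D → (Fin D → ℤ) → Fin D → (Fin D → ℤ) → MKer D F} {R BA BV BW cA cV cW θ : ℝ} {N : ℕ}

/-- **(UD) for the family** `j ↦ hessKer (A j) (V j) (W j)` from `j`-UNIFORM weighted data: `LimitRate.UniformDecay` with constant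
`hessW(B_A,B_V,B_W)` and rate `R·N`. [folklore] -/
theorem uniformDecay_hessKer_W (hA : ∀ j, ColW (A j) R BA) (hV : ∀ j, VertexFamilyW (V j) N R BV)
    (hW : ∀ j, VertexFamily₂W (W j) N R BW) (hR : 0 ≤ R) (μ ν : Fin D) :
    LimitRate.UniformDecay (fun j => hessKer (A j) (V j) (W j)) μ ν (hessW BA BV BW) (R * N) :=
  fun j => decay510_hessKer_W (hA j) (hV j) (hW j) hR μ ν

/-- **(PR) for the family**: ingredients converging GEOMETRICALLY in the weighted classes (`ColW (A j − A∞) R (cA θ^j)`,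
`VertexFamilyW (V j − V∞) N R (cV θ^j)`, `VertexFamily₂W (W j − W∞) N R (cW θ^j)`) ⟹ `LimitRate.GeometricRate` with constant
`lipW(B_A, B_A, B_V, B_V, B_W, cA, cV, cW)` and rate `R·N`. [folklore] -/
theorem geometricRate_hessKer_W (hA : ∀ j, ColW (A j) R BA) (hAinf : ColW Ainf R BA)
    (hArate : ∀ j, ColW (A j - Ainf) R (cA * θ ^ j))
    (hV : ∀ j, VertexFamilyW (V j) N R BV) (hVinf : VertexFamilyW Vinf N R BV)
    (hVrate : ∀ j, VertexFamilyW (V j - Vinf) N R (cV * θ ^ j))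
    (hW : ∀ j, VertexFamily₂W (W j) N R BW) (hWinf : VertexFamily₂W Winf N R BW)
    (hWrate : ∀ j, VertexFamily₂W (W j - Winf) N R (cW * θ ^ j)) (hR : 0 < R) (μ ν : Fin D) :
    LimitRate.GeometricRate (fun j => hessKer (A j) (V j) (W j)) (hessKer Ainf Vinf Winf) μ ν
      (lipW BA BA BV BV BW cA cV cW) (R * N) θ := by
  intro j
  have h := decay510_hessKer_sub_W (hA j) hAinf (hArate j) (hV j) hVinf (hVrate j) (hW j) hWinf (hWrate j) hR μ ν
  rw [lipW_mul] at h
  intro x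
  simpa [LimitRate.subKernel] using h x

/-- **(SW1)-SHAPE CONCLUSION WITH THE CONSTANT BUDGETED AT RATE `R·N`**: under the hypotheses of `geometricRate_hessKer_W` and `1 ≤ N`,
`RateCertificate.GeomRate (j ↦ secondMoment (hessKer (A j) (V j) (W j)) μ ν) (secondMoment (hessKer A∞ V∞ W∞) μ ν)
(betaPrime510 D (lipW B_A B_A B_V B_V B_W cA cV cW) (R·N)) θ` — i.e.
`c₀ = lipW(…) · Σ_{x∈ℤ^D} |x|₁² e^{−R·N·|x|₁}`. [folklore] -/
theorem geomRate_secondMoment_hessKer_W (hA : ∀ j, ColW (A j) R BA) (hAinf : ColW Ainf R BA)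
    (hArate : ∀ j, ColW (A j - Ainf) R (cA * θ ^ j))
    (hV : ∀ j, VertexFamilyW (V j) N R BV) (hVinf : VertexFamilyW Vinf N R BV)
    (hVrate : ∀ j, VertexFamilyW (V j - Vinf) N R (cV * θ ^ j))
    (hW : ∀ j, VertexFamily₂W (W j) N R BW) (hWinf : VertexFamily₂W Winf N R BW)
    (hWrate : ∀ j, VertexFamily₂W (W j - Winf) N R (cW * θ ^ j)) (hR : 0 < R) (hN : 1 ≤ N) (μ ν : Fin D) :
    RateCertificate.GeomRate (fun j => B12Beta.secondMoment (hessKer (A j) (V j) (W j)) μ ν)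
      (B12Beta.secondMoment (hessKer Ainf Vinf Winf) μ ν) (betaPrime510 D (lipW BA BA BV BV BW cA cV cW) (R * N)) θ := by
  have hRN : 0 < R * (N : ℝ) := mul_pos hR (by exact_mod_cast (show 0 < N by omega))
  exact fun j => LimitRate.abs_secondMoment_sub_limit_le (uniformDecay_hessKer_W hA hV hW hR.le μ ν)
    (geometricRate_hessKer_W hA hAinf hArate hV hVinf hVrate hW hWinf hWrate hR μ ν) hRN hRN j

/-- … the moments CONVERGE (`0 ≤ θ < 1`). [folklore] -/
theorem tendsto_secondMoment_hessKer_W (hA : ∀ j, ColW (A j) R BA) (hAinf : ColW Ainf R BA)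
    (hArate : ∀ j, ColW (A j - Ainf) R (cA * θ ^ j))
    (hV : ∀ j, VertexFamilyW (V j) N R BV) (hVinf : VertexFamilyW Vinf N R BV)
    (hVrate : ∀ j, VertexFamilyW (V j - Vinf) N R (cV * θ ^ j))
    (hW : ∀ j, VertexFamily₂W (W j) N R BW) (hWinf : VertexFamily₂W Winf N R BW)
    (hWrate : ∀ j, VertexFamily₂W (W j - Winf) N R (cW * θ ^ j)) (hR : 0 < R) (hN : 1 ≤ N) (hθ0 : 0 ≤ θ) (hθ1 : θ < 1)
    (μ ν : Fin D) :
    Tendsto (fun j => B12Beta.secondMoment (hessKer (A j) (V j) (W j)) μ ν) atTop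
      (nhds (B12Beta.secondMoment (hessKer Ainf Vinf Winf) μ ν)) :=
  (geomRate_secondMoment_hessKer_W hA hAinf hArate hV hVinf hVrate hW hWinf hWrate hR hN μ ν).tendsto hθ0 hθ1

/-- **THE ROAD-A2 SOCKET BY NAME** (`Drift.OneLoopDrift` via `RateCertificate.GeomRate.drift`), defect `c₀/(1 − θ)` with the
weighted `c₀`. [folklore] -/
theorem oneLoopDrift_secondMoment_hessKer_W (hA : ∀ j, ColW (A j) R BA) (hAinf : ColW Ainf R BA)
    (hArate : ∀ j, ColW (A j - Ainf) R (cA * θ ^ j))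
    (hV : ∀ j, VertexFamilyW (V j) N R BV) (hVinf : VertexFamilyW Vinf N R BV)
    (hVrate : ∀ j, VertexFamilyW (V j - Vinf) N R (cV * θ ^ j))
    (hW : ∀ j, VertexFamily₂W (W j) N R BW) (hWinf : VertexFamily₂W Winf N R BW)
    (hWrate : ∀ j, VertexFamily₂W (W j - Winf) N R (cW * θ ^ j)) (hR : 0 < R) (hN : 1 ≤ N) (hθ0 : 0 ≤ θ) (hθ1 : θ < 1)
    (μ ν : Fin D) :
    Drift.OneLoopDrift (B12Beta.secondMoment (hessKer Ainf Vinf Winf) μ ν)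
      (betaPrime510 D (lipW BA BA BV BV BW cA cV cW) (R * N) / (1 - θ))
      (fun j => B12Beta.secondMoment (hessKer (A j) (V j) (W j)) μ ν) :=
  (geomRate_secondMoment_hessKer_W hA hAinf hArate hV hVinf hVrate hW hWinf hWrate hR hN μ ν).drift hθ0 hθ1

/-- **THE SAME CONCLUSION FROM THE POINTWISE HYPOTHESES OF `HessKerRate` §4, AT ANY RATE `0 < R < δ`** — the (SW1) constant of
`HessKerRate.geomRate_secondMoment_hessKer` re-budgeted: decay length `R·N` instead of `δ/4`, the lattice constant `Zl(δ−R)` paid ONCE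
per factor (`|F|·Zl(δ−R)` per resolvent, `|F|²·Zl(δ−R)²` per vertex) instead of `Zl(δ/2)`, `Zl(δ/4)` per composition and trace.
[folklore] -/
theorem geomRate_secondMoment_hessKer_W_of_pointwise {C Cv Cw δ : ℝ} (hA : ∀ j, Decays (A j) C δ) (hAinf : Decays Ainf C δ)
    (hArate : ∀ j, Decays (A j - Ainf) (cA * θ ^ j) δ)
    (hV : ∀ j, VertexFamily (V j) N Cv δ) (hVinf : VertexFamily Vinf N Cv δ)
    (hVrate : ∀ j, VertexFamily (V j - Vinf) N (cV * θ ^ j) δ)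
    (hW : ∀ j, VertexFamily₂ (W j) N Cw δ) (hWinf : VertexFamily₂ Winf N Cw δ)
    (hWrate : ∀ j, VertexFamily₂ (W j - Winf) N (cW * θ ^ j) δ) (hR : 0 < R) (hRδ : R < δ) (hN : 1 ≤ N) (μ ν : Fin D) :
    RateCertificate.GeomRate (fun j => B12Beta.secondMoment (hessKer (A j) (V j) (W j)) μ ν)
      (B12Beta.secondMoment (hessKer Ainf Vinf Winf) μ ν)
      (betaPrime510 D
        (lipW ((Fintype.card F : ℝ) * C * Zl D (δ - R)) ((Fintype.card F : ℝ) * C * Zl D (δ - R))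
          ((Fintype.card F : ℝ) ^ 2 * Cv * Zl D (δ - R) ^ 2) ((Fintype.card F : ℝ) ^ 2 * Cv * Zl D (δ - R) ^ 2)
          ((Fintype.card F : ℝ) ^ 2 * Cw * Zl D (δ - R) ^ 2) ((Fintype.card F : ℝ) * cA * Zl D (δ - R))
          ((Fintype.card F : ℝ) ^ 2 * cV * Zl D (δ - R) ^ 2) ((Fintype.card F : ℝ) ^ 2 * cW * Zl D (δ - R) ^ 2))
        (R * N)) θ :=
  geomRate_secondMoment_hessKer_W (fun j => colW_of_decays (hA j) hRδ) (colW_of_decays hAinf hRδ)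
    (fun j => (colW_of_decays (hArate j) hRδ).mono (le_of_eq (by ring)))
    (fun j => vertexFamilyW_of_vertexFamily (hV j) hRδ) (vertexFamilyW_of_vertexFamily hVinf hRδ)
    (fun j => (vertexFamilyW_of_vertexFamily (hVrate j) hRδ).mono (le_of_eq (by ring)))
    (fun j => vertexFamily₂W_of_vertexFamily₂ (hW j) hRδ) (vertexFamily₂W_of_vertexFamily₂ hWinf hRδ)
    (fun j => (vertexFamily₂W_of_vertexFamily₂ (hWrate j) hRδ).mono (le_of_eq (by ring))) hR hN μ ν

end Rate

/-! ## §6 (v1.1) HALF-RATE FIRST-ORDER VERTICES SUFFICE: the bubble has TWO localisation legs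

In `decay510_hessKer_W` the bubble channel decays like `e^{−2(R·N)|z|₁}` and one factor was discarded.  Keeping it, the
first-order vertex family may sit at rate `R/2` per leg (the resolvent and the second-order vertex at rate `R`) and the output
still decays at rate `R·N`: `decay510_hessKer_halfV` and its Lipschitz / rate twins.  This is the slot that the chain-rule vertex
`vertexOfK K N S` actually fills (§7: a column of `K` at rate `R` localises BOTH legs of the stencil, hence rate `R/2` per leg),
so the resolvent's full column rate `R` — not `R/2`, not `δ/8` — is the decay length of the step kernel in the coarse variable. -/

/-- Monotonicity of `ColW` in the RATE: a smaller rate has smaller weights. [folklore] -/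
theorem ColW.of_le {K : MKer D F} {R R' B : ℝ} (h : ColW K R B) (hR : R' ≤ R) : ColW K R' B :=
  ⟨h.1, fun y b s => le_trans (Finset.sum_le_sum fun _ _ => Finset.sum_le_sum fun _ _ =>
    mul_le_mul_of_nonneg_left (Real.exp_le_exp.mpr (mul_le_mul_of_nonneg_right hR (l1_nonneg _))) (abs_nonneg _))
    (h.2 y b s)⟩

/-- Monotonicity of `BiW` in the rate. [folklore] -/
theorem BiW.of_le {K : MKer D F} {p q : Fin D → ℤ} {R R' B : ℝ} (h : BiW K p q R B) (hR : R' ≤ R) : BiW K p q R' B :=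
  fun s t => le_trans (Finset.sum_le_sum fun _ _ => Finset.sum_le_sum fun _ _ => Finset.sum_le_sum fun _ _ =>
    Finset.sum_le_sum fun _ _ => mul_le_mul_of_nonneg_left
      (Real.exp_le_exp.mpr (mul_le_mul_of_nonneg_right hR (add_nonneg (l1_nonneg _) (l1_nonneg _)))) (abs_nonneg _)) (h s t)

/-- Monotonicity of `VertexFamilyW` in the rate. [folklore] -/
theorem VertexFamilyW.of_le {V : Fin D → (Fin D → ℤ) → MKer D F} {N : ℕ} {R R' B : ℝ} (h : VertexFamilyW V N R B)
    (hR : R' ≤ R) : VertexFamilyW V N R' B :=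
  fun μ y => (h μ y).of_le hR

/-- Monotonicity of `VertexFamily₂W` in the rate. [folklore] -/
theorem VertexFamily₂W.of_le {W : Fin D → (Fin D → ℤ) → Fin D → (Fin D → ℤ) → MKer D F} {N : ℕ} {R R' B : ℝ}
    (h : VertexFamily₂W W N R B) (hR : R' ≤ R) : VertexFamily₂W W N R' B :=
  fun μ y ν y' => (h μ y ν y').of_le hR

/-- The two half-rate bubble factors recombine to the full rate. [folklore] -/
theorem exp_half_mul_exp_half (R : ℝ) (N : ℕ) (z : Fin D → ℤ) :
    Real.exp (-(R / 2) * ((N : ℝ) * l1 z)) * Real.exp (-(R / 2) * ((N : ℝ) * l1 z)) = Real.exp (-(R * N) * l1 z) := by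
  rw [← Real.exp_add]; congr 1; ring

/-- **(5.10)-DECAY AT RATE `R·N` WITH HALF-RATE FIRST-ORDER VERTICES**: `ColW A R B_A`, `VertexFamilyW V N (R/2) B_V`,
`VertexFamily₂W W N R B_W`, `0 ≤ R` ⟹ `Decay510 (hessKer A V W μ ν) (hessW B_A B_V B_W) (R·N)`. [folklore] -/
theorem decay510_hessKer_halfV {A : MKer D F} {V : Fin D → (Fin D → ℤ) → MKer D F}
    {W : Fin D → (Fin D → ℤ) → Fin D → (Fin D → ℤ) → MKer D F} {R BA BV BW : ℝ} {N : ℕ}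
    (hA : ColW A R BA) (hV : VertexFamilyW V N (R / 2) BV) (hW : VertexFamily₂W W N R BW) (hR : 0 ≤ R) (μ ν : Fin D) :
    Decay510 (hessKer A V W μ ν) (hessW BA BV BW) (R * N) := by
  intro z
  have hR2 : 0 ≤ R / 2 := by linarith
  have hA2 : ColW A (R / 2) BA := hA.of_le (by linarith)
  have hW0 : BiW (W μ 0 ν z) 0 ((N : ℤ) • z) R BW := by simpa using hW μ 0 ν z
  have hV0 : BiW (V μ 0) 0 0 (R / 2) BV := by simpa using hV μ 0
  have ht := abs_tadpole_le_W hA hW0 hR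
  have hb := abs_bubble_le_W hA2 hV0 (hV ν z) hR2
  rw [l1_zero_sub_natSmul] at ht hb
  have he : Real.exp (-R * ((N : ℝ) * l1 z)) = Real.exp (-(R * N) * l1 z) := by congr 1; ring
  rw [he] at ht
  have hb' : |bubble A (V μ 0) (V ν z)| ≤ BA * BV * (BA * BV) * Real.exp (-(R * N) * l1 z) := by
    refine hb.trans (le_of_eq ?_)
    rw [← exp_half_mul_exp_half R N z]; ring
  set e := Real.exp (-(R * N) * l1 z) with hedef
  show |1 / 2 * tadpole A (W μ 0 ν z) - 1 / 2 * bubble A (V μ 0) (V ν z)| ≤ hessW BA BV BW * e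
  calc |1 / 2 * tadpole A (W μ 0 ν z) - 1 / 2 * bubble A (V μ 0) (V ν z)|
      ≤ |1 / 2 * tadpole A (W μ 0 ν z)| + |1 / 2 * bubble A (V μ 0) (V ν z)| := abs_sub _ _
    _ = 1 / 2 * |tadpole A (W μ 0 ν z)| + 1 / 2 * |bubble A (V μ 0) (V ν z)| := by
        rw [abs_mul, abs_mul, abs_of_pos (by norm_num : (0:ℝ) < 1 / 2)]
    _ ≤ 1 / 2 * (BA * BW * e) + 1 / 2 * (BA * BV * (BA * BV) * e) := by gcongr
    _ = hessW BA BV BW * e := by unfold hessW; ring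

/-- … hence `AbsMoment₂` (`0 < R`, `1 ≤ N`). [folklore] -/
theorem absMoment₂_hessKer_halfV {A : MKer D F} {V : Fin D → (Fin D → ℤ) → MKer D F}
    {W : Fin D → (Fin D → ℤ) → Fin D → (Fin D → ℤ) → MKer D F} {R BA BV BW : ℝ} {N : ℕ}
    (hA : ColW A R BA) (hV : VertexFamilyW V N (R / 2) BV) (hW : VertexFamily₂W W N R BW) (hR : 0 < R) (hN : 1 ≤ N)
    (μ ν : Fin D) : DecimatedMomentSummable.AbsMoment₂ (hessKer A V W μ ν) :=
  DecimatedMomentSummable.absMoment₂_of_decay510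
    (mul_pos hR (by exact_mod_cast (show 0 < N by omega))) (decay510_hessKer_halfV hA hV hW hR.le μ ν)

/-- **THE LIPSCHITZ TWIN WITH HALF-RATE FIRST-ORDER VERTICES** (same constant `lipW`, rate `R·N`; `V, V′, V − V′` at rate `R/2`).
[folklore] -/
theorem decay510_hessKer_sub_halfV {A A' : MKer D F} {V V' : Fin D → (Fin D → ℤ) → MKer D F}
    {W W' : Fin D → (Fin D → ℤ) → Fin D → (Fin D → ℤ) → MKer D F} {R BA BA' BV BV' BW BW' εA εV εW : ℝ} {N : ℕ}
    (hA : ColW A R BA) (hA' : ColW A' R BA') (hAA : ColW (A - A') R εA)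
    (hV : VertexFamilyW V N (R / 2) BV) (hV' : VertexFamilyW V' N (R / 2) BV') (hVV : VertexFamilyW (V - V') N (R / 2) εV)
    (hW : VertexFamily₂W W N R BW) (hW' : VertexFamily₂W W' N R BW') (hWW : VertexFamily₂W (W - W') N R εW)
    (hR : 0 < R) (μ ν : Fin D) :
    Decay510 (fun z => hessKer A V W μ ν z - hessKer A' V' W' μ ν z) (lipW BA BA' BV BV' BW εA εV εW) (R * N) := by
  intro z
  have hR0 := hR.le
  have hR2 : 0 < R / 2 := by linarith
  have hR20 := hR2.le
  have hA2 : ColW A (R / 2) BA := hA.of_le (by linarith)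
  have hA2' : ColW A' (R / 2) BA' := hA'.of_le (by linarith)
  have hAA2 : ColW (A - A') (R / 2) εA := hAA.of_le (by linarith)
  -- the localised data at `0` and `N • z`
  have hW0 : BiW (W μ 0 ν z) 0 ((N : ℤ) • z) R BW := by simpa using hW μ 0 ν z
  have hW0' : BiW (W' μ 0 ν z) 0 ((N : ℤ) • z) R BW' := by simpa using hW' μ 0 ν z
  have hWW0 : BiW (W μ 0 ν z - W' μ 0 ν z) 0 ((N : ℤ) • z) R εW := by simpa using hWW μ 0 ν z
  have hV0 : BiW (V μ 0) 0 0 (R / 2) BV := by simpa using hV μ 0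
  have hV0' : BiW (V' μ 0) 0 0 (R / 2) BV' := by simpa using hV' μ 0
  have hVV0 : BiW (V μ 0 - V' μ 0) 0 0 (R / 2) εV := by simpa using hVV μ 0
  have hVz := hV ν z
  have hVz' := hV' ν z
  have hVVz : BiW (V ν z - V' ν z) ((N : ℤ) • z) ((N : ℤ) • z) (R / 2) εV := hVV ν z
  -- signs
  have hBA := hA.nonneg
  have hBA' := hA'.nonneg
  have hεA := hAA.nonneg
  have hBV := hV0.nonneg
  have hBV' := hV0'.nonneg
  have hεV := hVV0.nonneg
  have hBW := hW0.nonneg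
  have hεW := hWW0.nonneg
  -- TADPOLE channel at rate `R`
  have hT : |tadpole A (W μ 0 ν z) - tadpole A' (W' μ 0 ν z)| ≤ (εA * BW + BA' * εW) * Real.exp (-R * l1 ((0 : Fin D → ℤ) - (N : ℤ) • z)) := by
    rw [tadpole_sub_tadpole hA.decays hA'.decays hW0.biLoc hW0'.biLoc hR,
      comp_sub_comp hA.decays hA'.decays hW0.biLoc hW0'.biLoc hR]
    exact (abs_tr_le_biW ((biW_comp_colW hAA hW0 hR0).add (biW_comp_colW hA' hWW0 hR0)) hR0).2
  -- BUBBLE channel at rate `R/2`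
  have hX := biW_comp_colW hA2 hV0 hR20
  have hX' := biW_comp_colW hA2' hV0' hR20
  have hY := biW_comp_colW hA2 hVz hR20
  have hY' := biW_comp_colW hA2' hVz' hR20
  have hXX : BiW (comp A (V μ 0) - comp A' (V' μ 0)) 0 0 (R / 2) (εA * BV + BA' * εV) := by
    rw [comp_sub_comp hA2.decays hA2'.decays hV0.biLoc hV0'.biLoc hR2]
    exact (biW_comp_colW hAA2 hV0 hR20).add (biW_comp_colW hA2' hVV0 hR20)
  have hYY : BiW (comp A (V ν z) - comp A' (V' ν z)) ((N : ℤ) • z) ((N : ℤ) • z) (R / 2) (εA * BV + BA' * εV) := by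
    rw [comp_sub_comp hA2.decays hA2'.decays hVz.biLoc hVz'.biLoc hR2]
    exact (biW_comp_colW hAA2 hVz hR20).add (biW_comp_colW hA2' hVVz hR20)
  have hB : |bubble A (V μ 0) (V ν z) - bubble A' (V' μ 0) (V' ν z)| ≤
      ((εA * BV + BA' * εV) * (BA * BV) * Real.exp (-(R / 2) * l1 ((0 : Fin D → ℤ) - (N : ℤ) • z)) +
        BA' * BV' * (εA * BV + BA' * εV) * Real.exp (-(R / 2) * l1 ((0 : Fin D → ℤ) - (N : ℤ) • z))) *
        Real.exp (-(R / 2) * l1 ((0 : Fin D → ℤ) - (N : ℤ) • z)) := by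
    rw [bubble_sub_bubble hA2.decays hA2'.decays hV0.biLoc hV0'.biLoc hVz.biLoc hVz'.biLoc hR2,
      comp_sub_comp_bb hX.biLoc hX'.biLoc hY.biLoc hY'.biLoc hR2]
    exact (abs_tr_le_biW ((biW_comp_biW hXX hY hR20).add (biW_comp_biW hX' hYY hR20)) hR20).2
  -- rates: `|0 − N•z|₁ = N|z|₁`; the two half-rate factors recombine
  rw [l1_zero_sub_natSmul] at hT hB
  have he : Real.exp (-R * ((N : ℝ) * l1 z)) = Real.exp (-(R * N) * l1 z) := by congr 1; ring
  rw [he] at hT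
  have hB' : |bubble A (V μ 0) (V ν z) - bubble A' (V' μ 0) (V' ν z)| ≤
      ((εA * BV + BA' * εV) * (BA * BV) + BA' * BV' * (εA * BV + BA' * εV)) * Real.exp (-(R * N) * l1 z) := by
    refine hB.trans (le_of_eq ?_)
    rw [← exp_half_mul_exp_half R N z]; ring
  set e := Real.exp (-(R * N) * l1 z) with hedef
  show |(1 / 2 * tadpole A (W μ 0 ν z) - 1 / 2 * bubble A (V μ 0) (V ν z)) -
      (1 / 2 * tadpole A' (W' μ 0 ν z) - 1 / 2 * bubble A' (V' μ 0) (V' ν z))| ≤ lipW BA BA' BV BV' BW εA εV εW * e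
  rw [show (1 / 2 * tadpole A (W μ 0 ν z) - 1 / 2 * bubble A (V μ 0) (V ν z)) -
      (1 / 2 * tadpole A' (W' μ 0 ν z) - 1 / 2 * bubble A' (V' μ 0) (V' ν z)) =
      1 / 2 * (tadpole A (W μ 0 ν z) - tadpole A' (W' μ 0 ν z)) -
        1 / 2 * (bubble A (V μ 0) (V ν z) - bubble A' (V' μ 0) (V' ν z)) by ring]
  calc |1 / 2 * (tadpole A (W μ 0 ν z) - tadpole A' (W' μ 0 ν z)) -
        1 / 2 * (bubble A (V μ 0) (V ν z) - bubble A' (V' μ 0) (V' ν z))|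
      ≤ |1 / 2 * (tadpole A (W μ 0 ν z) - tadpole A' (W' μ 0 ν z))| +
          |1 / 2 * (bubble A (V μ 0) (V ν z) - bubble A' (V' μ 0) (V' ν z))| := abs_sub _ _
    _ = 1 / 2 * |tadpole A (W μ 0 ν z) - tadpole A' (W' μ 0 ν z)| +
          1 / 2 * |bubble A (V μ 0) (V ν z) - bubble A' (V' μ 0) (V' ν z)| := by
        rw [abs_mul, abs_mul, abs_of_pos (by norm_num : (0:ℝ) < 1 / 2)]
    _ ≤ 1 / 2 * ((εA * BW + BA' * εW) * e) +
          1 / 2 * (((εA * BV + BA' * εV) * (BA * BV) + BA' * BV' * (εA * BV + BA' * εV)) * e) := by gcongr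
    _ = lipW BA BA' BV BV' BW εA εV εW * e := by unfold lipW; ring

section RateHalfV

variable {A : ℕ → MKer D F} {Ainf : MKer D F} {V : ℕ → Fin D → (Fin D → ℤ) → MKer D F}
  {Vinf : Fin D → (Fin D → ℤ) → MKer D F} {W : ℕ → Fin D → (Fin D → ℤ) → Fin D → (Fin D → ℤ) → MKer D F}
  {Winf : Fin D → (Fin D → ℤ) → Fin D → (Fin D → ℤ) → MKer D F} {R BA BV BW cA cV cW θ : ℝ} {N : ℕ}

/-- (UD) with half-rate first-order vertices. [folklore] -/
theorem uniformDecay_hessKer_halfV (hA : ∀ j, ColW (A j) R BA) (hV : ∀ j, VertexFamilyW (V j) N (R / 2) BV)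
    (hW : ∀ j, VertexFamily₂W (W j) N R BW) (hR : 0 ≤ R) (μ ν : Fin D) :
    LimitRate.UniformDecay (fun j => hessKer (A j) (V j) (W j)) μ ν (hessW BA BV BW) (R * N) :=
  fun j => decay510_hessKer_halfV (hA j) (hV j) (hW j) hR μ ν

/-- (PR) with half-rate first-order vertices. [folklore] -/
theorem geometricRate_hessKer_halfV (hA : ∀ j, ColW (A j) R BA) (hAinf : ColW Ainf R BA)
    (hArate : ∀ j, ColW (A j - Ainf) R (cA * θ ^ j))
    (hV : ∀ j, VertexFamilyW (V j) N (R / 2) BV) (hVinf : VertexFamilyW Vinf N (R / 2) BV)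
    (hVrate : ∀ j, VertexFamilyW (V j - Vinf) N (R / 2) (cV * θ ^ j))
    (hW : ∀ j, VertexFamily₂W (W j) N R BW) (hWinf : VertexFamily₂W Winf N R BW)
    (hWrate : ∀ j, VertexFamily₂W (W j - Winf) N R (cW * θ ^ j)) (hR : 0 < R) (μ ν : Fin D) :
    LimitRate.GeometricRate (fun j => hessKer (A j) (V j) (W j)) (hessKer Ainf Vinf Winf) μ ν
      (lipW BA BA BV BV BW cA cV cW) (R * N) θ := by
  intro j
  have h := decay510_hessKer_sub_halfV (hA j) hAinf (hArate j) (hV j) hVinf (hVrate j) (hW j) hWinf (hWrate j) hR μ ν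
  rw [lipW_mul] at h
  intro x
  simpa [LimitRate.subKernel] using h x

/-- **(SW1)-SHAPE CONCLUSION, HALF-RATE VERTICES, CONSTANT AT RATE `R·N`.** [folklore] -/
theorem geomRate_secondMoment_hessKer_halfV (hA : ∀ j, ColW (A j) R BA) (hAinf : ColW Ainf R BA)
    (hArate : ∀ j, ColW (A j - Ainf) R (cA * θ ^ j))
    (hV : ∀ j, VertexFamilyW (V j) N (R / 2) BV) (hVinf : VertexFamilyW Vinf N (R / 2) BV)
    (hVrate : ∀ j, VertexFamilyW (V j - Vinf) N (R / 2) (cV * θ ^ j))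
    (hW : ∀ j, VertexFamily₂W (W j) N R BW) (hWinf : VertexFamily₂W Winf N R BW)
    (hWrate : ∀ j, VertexFamily₂W (W j - Winf) N R (cW * θ ^ j)) (hR : 0 < R) (hN : 1 ≤ N) (μ ν : Fin D) :
    RateCertificate.GeomRate (fun j => B12Beta.secondMoment (hessKer (A j) (V j) (W j)) μ ν)
      (B12Beta.secondMoment (hessKer Ainf Vinf Winf) μ ν) (betaPrime510 D (lipW BA BA BV BV BW cA cV cW) (R * N)) θ := by
  have hRN : 0 < R * (N : ℝ) := mul_pos hR (by exact_mod_cast (show 0 < N by omega))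
  exact fun j => LimitRate.abs_secondMoment_sub_limit_le (uniformDecay_hessKer_halfV hA hV hW hR.le μ ν)
    (geometricRate_hessKer_halfV hA hAinf hArate hV hVinf hVrate hW hWinf hWrate hR μ ν) hRN hRN j

/-- … and the road-A2 socket by name. [folklore] -/
theorem oneLoopDrift_secondMoment_hessKer_halfV (hA : ∀ j, ColW (A j) R BA) (hAinf : ColW Ainf R BA)
    (hArate : ∀ j, ColW (A j - Ainf) R (cA * θ ^ j))
    (hV : ∀ j, VertexFamilyW (V j) N (R / 2) BV) (hVinf : VertexFamilyW Vinf N (R / 2) BV)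
    (hVrate : ∀ j, VertexFamilyW (V j - Vinf) N (R / 2) (cV * θ ^ j))
    (hW : ∀ j, VertexFamily₂W (W j) N R BW) (hWinf : VertexFamily₂W Winf N R BW)
    (hWrate : ∀ j, VertexFamily₂W (W j - Winf) N R (cW * θ ^ j)) (hR : 0 < R) (hN : 1 ≤ N) (hθ0 : 0 ≤ θ) (hθ1 : θ < 1)
    (μ ν : Fin D) :
    Drift.OneLoopDrift (B12Beta.secondMoment (hessKer Ainf Vinf Winf) μ ν)
      (betaPrime510 D (lipW BA BA BV BV BW cA cV cW) (R * N) / (1 - θ))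
      (fun j => B12Beta.secondMoment (hessKer (A j) (V j) (W j)) μ ν) :=
  (geomRate_secondMoment_hessKer_halfV hA hAinf hArate hV hVinf hVrate hW hWinf hWrate hR hN μ ν).drift hθ0 hθ1

end RateHalfV

/-! ## §7 (v1.1) THE CHAIN-RULE VERTEX `vertexOfK K N S` IN THE WEIGHTED CLASSES: rate `R/2` per leg from a column at rate `R`

`vertexOfK K N S μ y = Σ_{κ′} wsum (colH K N μ y κ′) (S κ′)` (`OneStepKernelFamily` §3): the weights are the `ℋ`-column of `K` at
`(N•y, inr μ)`, the stencils `S κ′ u` are self-localised at `u`.  With the column in `ColW K R B_K` and the stencils in the weighted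
class `LocStencilW S (R/2) B_s`, the vertex is `VertexFamilyW (vertexOfK K N S) N (R/2) (B_K·B_s)` — NO lattice constant, the
factor `d+1` of the pointwise version absorbed into the fibre sum of the column — and Lipschitz in `(K, S)` with constant
`εK·B_s + B_K′·εS`.  Hence the END-TO-END statement from the PRIMITIVES `(K_j, S_j, W_j)` (the literal shape of
`OneStepKernelFamily.TstepOf`): `geomRate_secondMoment_hessKer_primitivesW`, constant
`betaPrime510 (d+1) (lipW B_K B_K (B_K B_s) (B_K B_s) B_W c_K (c_K B_s + B_K c_S) c_W) (R·N)`. -/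

section VertexW

open Literature.MathematicalPhysics.QuantumFieldTheory.Balaban1983to89.Beta.OneStepResolventKernel (Fib wsum LocStencil)
open Literature.MathematicalPhysics.QuantumFieldTheory.Balaban1983to89.Beta.OneStepKernelFamily (colH vertexOfK)
open Literature.MathematicalPhysics.QuantumFieldTheory.Balaban1983to89.Beta.HessKerRate (wsum_sub_wsum colH_sub)

variable {d : ℕ}

/-- The zero kernel is in every `BiW` class with bound `0`. [folklore] -/
theorem biW_zero (p q : Fin D → ℤ) (R : ℝ) : BiW (0 : MKer D F) p q R 0 := fun s t => by simp

/-- `BiW` of a finite sum of kernels. [folklore] -/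
theorem BiW.finset_sum {ι : Type*} (T : Finset ι) {X : ι → MKer D F} {p q : Fin D → ℤ} {R : ℝ} {B : ι → ℝ}
    (h : ∀ k ∈ T, BiW (X k) p q R (B k)) : BiW (∑ k ∈ T, X k) p q R (∑ k ∈ T, B k) := by
  classical
  induction T using Finset.induction_on with
  | empty => simpa using biW_zero (F := F) p q R
  | insert a T ha ih =>
    rw [Finset.sum_insert ha, Finset.sum_insert ha]
    exact (h a (Finset.mem_insert_self a T)).add (ih fun k hk => h k (Finset.mem_insert_of_mem hk))

/-- **WEIGHTED SUPERPOSITION IN THE WEIGHTED CLASSES**: weights with `Σ_{u∈U} |w u|·e^{R|u−p|₁} ≤ B_w` for every finite `U` and a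
family `K u` self-localised at `u` at rate `R/2` with bound `B_k` ⟹ `BiW (wsum w K) p p (R/2) (B_w·B_k)` (`0 < R`; the rate `R` of
the weights pays for BOTH legs `|x−p|₁ ≤ |x−u|₁ + |u−p|₁`, `|z−p|₁ ≤ |z−u|₁ + |u−p|₁`). [folklore] -/
theorem biW_wsum_W {w : (Fin D → ℤ) → ℝ} {K : (Fin D → ℤ) → MKer D F} {p : Fin D → ℤ} {R Bw Bk : ℝ}
    (hw : ∀ U : Finset (Fin D → ℤ), ∑ u ∈ U, |w u| * Real.exp (R * l1 (u - p)) ≤ Bw)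
    (hK : ∀ u, BiW (K u) u u (R / 2) Bk) (hR : 0 < R) : BiW (wsum w K) p p (R / 2) (Bw * Bk) := by
  classical
  have hBk : 0 ≤ Bk := (hK p).nonneg
  have hP0 : ∀ u, 0 ≤ |w u| * Real.exp (R * l1 (u - p)) := fun u => by positivity
  have hQ0 : ∀ u (x z : Fin D → ℤ) (a b : F), 0 ≤ |K u x z a b| * Real.exp (R / 2 * (l1 (x - u) + l1 (z - u))) :=
    fun u x z a b => by positivity
  have hQle : ∀ u (x z : Fin D → ℤ) (a b : F), |K u x z a b| * Real.exp (R / 2 * (l1 (x - u) + l1 (z - u))) ≤ Bk :=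
    fun u x z a b => (hK u).entry_le x z a b
  -- the majorant `u ↦ (|w u| e^{R|u−p|})·(|K u x z a b| e^{(R/2)(|x−u|+|z−u|)})` is summable
  have hsm : ∀ (x z : Fin D → ℤ) (a b : F), Summable fun u =>
      |w u| * Real.exp (R * l1 (u - p)) * (|K u x z a b| * Real.exp (R / 2 * (l1 (x - u) + l1 (z - u)))) := by
    intro x z a b
    refine summable_of_sum_le (c := Bw * Bk) (fun u => mul_nonneg (hP0 u) (hQ0 u x z a b)) fun U => ?_
    calc ∑ u ∈ U, |w u| * Real.exp (R * l1 (u - p)) * (|K u x z a b| * Real.exp (R / 2 * (l1 (x - u) + l1 (z - u))))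
        ≤ ∑ u ∈ U, |w u| * Real.exp (R * l1 (u - p)) * Bk :=
          Finset.sum_le_sum fun u _ => mul_le_mul_of_nonneg_left (hQle u x z a b) (hP0 u)
      _ = (∑ u ∈ U, |w u| * Real.exp (R * l1 (u - p))) * Bk := by rw [Finset.sum_mul]
      _ ≤ Bw * Bk := mul_le_mul_of_nonneg_right (hw U) hBk
  -- termwise domination of the superposition
  have hdom : ∀ (x z : Fin D → ℤ) (a b : F), |wsum w K x z a b| * Real.exp (R / 2 * (l1 (x - p) + l1 (z - p))) ≤
      ∑' u, |w u| * Real.exp (R * l1 (u - p)) * (|K u x z a b| * Real.exp (R / 2 * (l1 (x - u) + l1 (z - u)))) := by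
    intro x z a b
    have hterm : ∀ u, ‖w u * K u x z a b‖ ≤ |w u| * Real.exp (R * l1 (u - p)) *
        (|K u x z a b| * Real.exp (R / 2 * (l1 (x - u) + l1 (z - u)))) / Real.exp (R / 2 * (l1 (x - p) + l1 (z - p))) := by
      intro u
      rw [le_div_iff₀ (Real.exp_pos _), Real.norm_eq_abs, abs_mul]
      have hexp : Real.exp (R / 2 * (l1 (x - p) + l1 (z - p))) ≤
          Real.exp (R * l1 (u - p)) * Real.exp (R / 2 * (l1 (x - u) + l1 (z - u))) := by
        rw [← Real.exp_add, Real.exp_le_exp]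
        have h1 := l1_sub_triangle x u p
        have h2 := l1_sub_triangle z u p
        have h1' := mul_le_mul_of_nonneg_left h1 hR.le
        have h2' := mul_le_mul_of_nonneg_left h2 hR.le
        linarith
      calc |w u| * |K u x z a b| * Real.exp (R / 2 * (l1 (x - p) + l1 (z - p)))
          ≤ |w u| * |K u x z a b| * (Real.exp (R * l1 (u - p)) * Real.exp (R / 2 * (l1 (x - u) + l1 (z - u)))) :=
            mul_le_mul_of_nonneg_left hexp (by positivity)
        _ = |w u| * Real.exp (R * l1 (u - p)) * (|K u x z a b| * Real.exp (R / 2 * (l1 (x - u) + l1 (z - u)))) := by ring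
    have hb := tsum_of_norm_bounded ((hsm x z a b).hasSum.div_const _) hterm
    rw [Real.norm_eq_abs] at hb
    show |∑' u, w u * K u x z a b| * _ ≤ _
    exact (le_div_iff₀ (Real.exp_pos _)).mp hb
  -- Schur exchange over the flattened index `(x, z, a, b)`
  intro s t
  have hflat : ∀ g : (Fin D → ℤ) → (Fin D → ℤ) → F → F → ℝ,
      ∑ i ∈ (s ×ˢ t) ×ˢ ((Finset.univ : Finset F) ×ˢ (Finset.univ : Finset F)), g i.1.1 i.1.2 i.2.1 i.2.2 =
        ∑ x ∈ s, ∑ z ∈ t, ∑ a, ∑ b, g x z a b := fun g => by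
    simp only [Finset.sum_product]
  have hM : ∀ U : Finset (Fin D → ℤ), ∑ u ∈ U, ∑ i ∈ (s ×ˢ t) ×ˢ ((Finset.univ : Finset F) ×ˢ (Finset.univ : Finset F)),
      |w u| * Real.exp (R * l1 (u - p)) *
        (|K u i.1.1 i.1.2 i.2.1 i.2.2| * Real.exp (R / 2 * (l1 (i.1.1 - u) + l1 (i.1.2 - u)))) ≤ Bw * Bk := by
    intro U
    have hin : ∀ u, ∑ i ∈ (s ×ˢ t) ×ˢ ((Finset.univ : Finset F) ×ˢ (Finset.univ : Finset F)),
        |w u| * Real.exp (R * l1 (u - p)) *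
          (|K u i.1.1 i.1.2 i.2.1 i.2.2| * Real.exp (R / 2 * (l1 (i.1.1 - u) + l1 (i.1.2 - u)))) ≤
        |w u| * Real.exp (R * l1 (u - p)) * Bk := by
      intro u
      rw [← Finset.mul_sum, hflat (fun x z a b => |K u x z a b| * Real.exp (R / 2 * (l1 (x - u) + l1 (z - u))))]
      exact mul_le_mul_of_nonneg_left (hK u s t) (hP0 u)
    calc _ ≤ ∑ u ∈ U, |w u| * Real.exp (R * l1 (u - p)) * Bk := Finset.sum_le_sum fun u _ => hin u
      _ = (∑ u ∈ U, |w u| * Real.exp (R * l1 (u - p))) * Bk := by rw [Finset.sum_mul]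
      _ ≤ Bw * Bk := mul_le_mul_of_nonneg_right (hw U) hBk
  have key := (sum_tsum_le ((s ×ˢ t) ×ˢ ((Finset.univ : Finset F) ×ˢ (Finset.univ : Finset F)))
    (m := fun i u => |w u| * Real.exp (R * l1 (u - p)) *
      (|K u i.1.1 i.1.2 i.2.1 i.2.2| * Real.exp (R / 2 * (l1 (i.1.1 - u) + l1 (i.1.2 - u)))))
    (fun i u => mul_nonneg (hP0 u) (hQ0 _ _ _ _ _)) hM).2
  calc ∑ x ∈ s, ∑ z ∈ t, ∑ a, ∑ b, |wsum w K x z a b| * Real.exp (R / 2 * (l1 (x - p) + l1 (z - p)))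
      ≤ ∑ x ∈ s, ∑ z ∈ t, ∑ a, ∑ b, ∑' u, |w u| * Real.exp (R * l1 (u - p)) *
          (|K u x z a b| * Real.exp (R / 2 * (l1 (x - u) + l1 (z - u)))) :=
        Finset.sum_le_sum fun x _ => Finset.sum_le_sum fun z _ => Finset.sum_le_sum fun a _ =>
          Finset.sum_le_sum fun b _ => hdom x z a b
    _ = ∑ i ∈ (s ×ˢ t) ×ˢ ((Finset.univ : Finset F) ×ˢ (Finset.univ : Finset F)), ∑' u, |w u| * Real.exp (R * l1 (u - p)) *
          (|K u i.1.1 i.1.2 i.2.1 i.2.2| * Real.exp (R / 2 * (l1 (i.1.1 - u) + l1 (i.1.2 - u)))) :=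
        (hflat (fun x z a b => ∑' u, |w u| * Real.exp (R * l1 (u - p)) *
          (|K u x z a b| * Real.exp (R / 2 * (l1 (x - u) + l1 (z - u)))))).symm
    _ ≤ Bw * Bk := key

/-- A WEIGHTED LOCAL STENCIL TABLE: `S κ′ u` in `BiW` at `(u, u)` with rate `R` and bound `B_s`, uniformly. [folklore] -/
def LocStencilW (S : Fin (d + 1) → (Fin (d + 1) → ℤ) → MKer (d + 1) (Fib d)) (R Bs : ℝ) : Prop :=
  ∀ κ' u, BiW (S κ' u) u u R Bs

/-- The pointwise class follows. [folklore] -/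
theorem LocStencilW.locStencil {S : Fin (d + 1) → (Fin (d + 1) → ℤ) → MKer (d + 1) (Fib d)} {R Bs : ℝ}
    (h : LocStencilW S R Bs) : LocStencil S Bs R :=
  fun κ' u => (h κ' u).biLoc

/-- The bound of a weighted stencil table is nonnegative. [folklore] -/
theorem LocStencilW.nonneg {S : Fin (d + 1) → (Fin (d + 1) → ℤ) → MKer (d + 1) (Fib d)} {R Bs : ℝ}
    (h : LocStencilW S R Bs) : 0 ≤ Bs :=
  (h 0 0).nonneg

/-- Monotonicity of `LocStencilW` in the bound. [folklore] -/
theorem LocStencilW.mono {S : Fin (d + 1) → (Fin (d + 1) → ℤ) → MKer (d + 1) (Fib d)} {R Bs Bs' : ℝ}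
    (h : LocStencilW S R Bs) (hB : Bs ≤ Bs') : LocStencilW S R Bs' :=
  fun κ' u => (h κ' u).mono hB

/-- CONVERSION: a pointwise `LocStencil S Cs δ` is a weighted one at any `R < δ`, bound `|Fib d|²·Cs·Zl(δ−R)²`. [folklore] -/
theorem locStencilW_of_locStencil {S : Fin (d + 1) → (Fin (d + 1) → ℤ) → MKer (d + 1) (Fib d)} {Cs δ R : ℝ}
    (h : LocStencil S Cs δ) (hR : R < δ) :
    LocStencilW S R ((Fintype.card (Fib d) : ℝ) ^ 2 * Cs * Zl (d + 1) (δ - R) ^ 2) :=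
  fun κ' u => biW_of_biLoc (h κ' u) hR

/-- THE `κ′`-SLICES OF THE WEIGHTED `ℋ`-COLUMN: from `ColW K R B_K`, every slice `u ↦ |colH K N μ y κ′ u|·e^{R|u−N•y|₁}` is
summable and the slices' sums add up to at most `B_K` (the factor `d+1` is absorbed into the fibre sum). [folklore] -/
theorem colH_slices {K : MKer (d + 1) (Fib d)} {R BK : ℝ} (hK : ColW K R BK) (N : ℕ) (μ : Fin (d + 1))
    (y : Fin (d + 1) → ℤ) :
    (∀ κ' : Fin (d + 1), Summable fun u => |colH K N μ y κ' u| * Real.exp (R * l1 (u - (N : ℤ) • y))) ∧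
      ∑ κ' : Fin (d + 1), ∑' u, |colH K N μ y κ' u| * Real.exp (R * l1 (u - (N : ℤ) • y)) ≤ BK := by
  classical
  have h0 : ∀ u (a : Fib d), 0 ≤ |K u ((N : ℤ) • y) a (Sum.inr μ)| * Real.exp (R * l1 (u - (N : ℤ) • y)) :=
    fun u a => by positivity
  have hs : Summable fun u => ∑ a, |K u ((N : ℤ) • y) a (Sum.inr μ)| * Real.exp (R * l1 (u - (N : ℤ) • y)) :=
    summable_of_sum_le (fun u => Finset.sum_nonneg fun a _ => h0 u a) (hK.2 ((N : ℤ) • y) (Sum.inr μ))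
  have hle : ∑' u, ∑ a, |K u ((N : ℤ) • y) a (Sum.inr μ)| * Real.exp (R * l1 (u - (N : ℤ) • y)) ≤ BK :=
    hs.tsum_le_of_sum_le (hK.2 _ _)
  have hsl : ∀ κ' : Fin (d + 1), Summable fun u => |colH K N μ y κ' u| * Real.exp (R * l1 (u - (N : ℤ) • y)) := by
    intro κ'
    refine hs.of_nonneg_of_le (fun u => by positivity) fun u => ?_
    exact Finset.single_le_sum (f := fun a => |K u ((N : ℤ) • y) a (Sum.inr μ)| * Real.exp (R * l1 (u - (N : ℤ) • y)))
      (fun a _ => h0 u a) (Finset.mem_univ (Sum.inl κ'))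
  refine ⟨hsl, ?_⟩
  calc ∑ κ' : Fin (d + 1), ∑' u, |colH K N μ y κ' u| * Real.exp (R * l1 (u - (N : ℤ) • y))
      = ∑' u, ∑ κ' : Fin (d + 1), |colH K N μ y κ' u| * Real.exp (R * l1 (u - (N : ℤ) • y)) :=
        (Summable.tsum_finsetSum (fun κ' _ => hsl κ')).symm
    _ ≤ ∑' u, ∑ a, |K u ((N : ℤ) • y) a (Sum.inr μ)| * Real.exp (R * l1 (u - (N : ℤ) • y)) := by
        refine Summable.tsum_le_tsum (fun u => ?_) (summable_sum fun κ' _ => hsl κ') hs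
        rw [Fintype.sum_sum_type]
        simp only [colH]
        exact le_add_of_nonneg_right (Finset.sum_nonneg fun c _ => h0 u (Sum.inr c))
    _ ≤ BK := hle

/-- The vertex as a finite sum of superpositions (function form of the definition). [folklore] -/
theorem vertexOfK_eq_sum (K : MKer (d + 1) (Fib d)) (N : ℕ) (S : Fin (d + 1) → (Fin (d + 1) → ℤ) → MKer (d + 1) (Fib d))
    (μ : Fin (d + 1)) (y : Fin (d + 1) → ℤ) :
    vertexOfK K N S μ y = ∑ κ' : Fin (d + 1), wsum (colH K N μ y κ') (S κ') := by
  funext x z a b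
  simp only [vertexOfK, Finset.sum_apply]

/-- **THE CHAIN-RULE VERTEX IN THE WEIGHTED CLASSES**: `ColW K R B_K`, `LocStencilW S (R/2) B_s`, `0 < R` ⟹
`VertexFamilyW (vertexOfK K N S) N (R/2) (B_K·B_s)` — exactly the half-rate slot of `decay510_hessKer_halfV`. [folklore] -/
theorem vertexFamilyW_vertexOfK {K : MKer (d + 1) (Fib d)} {R BK : ℝ} (hK : ColW K R BK)
    {S : Fin (d + 1) → (Fin (d + 1) → ℤ) → MKer (d + 1) (Fib d)} {Bs : ℝ} (hS : LocStencilW S (R / 2) Bs) (hR : 0 < R)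
    (N : ℕ) : VertexFamilyW (vertexOfK K N S) N (R / 2) (BK * Bs) := by
  classical
  intro μ y
  obtain ⟨hsl, hle⟩ := colH_slices hK N μ y
  have hterm : ∀ κ' : Fin (d + 1), BiW (wsum (colH K N μ y κ') (S κ')) ((N : ℤ) • y) ((N : ℤ) • y) (R / 2)
      ((∑' u, |colH K N μ y κ' u| * Real.exp (R * l1 (u - (N : ℤ) • y))) * Bs) := fun κ' =>
    biW_wsum_W (fun U => (hsl κ').sum_le_tsum U (fun u _ => by positivity)) (fun u => hS κ' u) hR
  have hsum := BiW.finset_sum (Finset.univ : Finset (Fin (d + 1))) (fun κ' _ => hterm κ')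
  rw [vertexOfK_eq_sum]
  refine hsum.mono ?_
  rw [← Finset.sum_mul]
  exact mul_le_mul_of_nonneg_right hle hS.nonneg

/-- Pointwise weights from a weighted column, at the smaller rate `R/2`. [folklore] -/
theorem abs_colH_le_W {K : MKer (d + 1) (Fib d)} {R BK : ℝ} (hK : ColW K R BK) (hR : 0 ≤ R) (N : ℕ) (μ : Fin (d + 1))
    (y : Fin (d + 1) → ℤ) (κ' : Fin (d + 1)) (u : Fin (d + 1) → ℤ) :
    |colH K N μ y κ' u| ≤ BK * Real.exp (-(R / 2) * l1 (u - (N : ℤ) • y)) := by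
  have h1 := le_mul_exp_neg_of_mul_exp_le (hK.entry_le u ((N : ℤ) • y) (Sum.inl κ') (Sum.inr μ))
  refine h1.trans (mul_le_mul_of_nonneg_left (Real.exp_le_exp.mpr ?_) hK.nonneg)
  have := l1_nonneg (u - (N : ℤ) • y)
  nlinarith

/-- **THE CHAIN-RULE VERTEX IS LIPSCHITZ IN `(K, S)` IN THE WEIGHTED CLASSES**: columns `B_K, B_K′`, difference `εK` at rate `R`;
stencils `B_s, B_s′`, difference `εS` at rate `R/2` ⟹ `VertexFamilyW (vertexOfK K N S − vertexOfK K′ N S′) N (R/2) (εK·B_s + B_K′·εS)`.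
[folklore] -/
theorem vertexFamilyW_vertexOfK_sub {K K' : MKer (d + 1) (Fib d)} {R BK BK' εK : ℝ} (hK : ColW K R BK) (hK' : ColW K' R BK')
    (hKK : ColW (K - K') R εK) {S S' : Fin (d + 1) → (Fin (d + 1) → ℤ) → MKer (d + 1) (Fib d)} {Bs Bs' εS : ℝ}
    (hS : LocStencilW S (R / 2) Bs) (hS' : LocStencilW S' (R / 2) Bs') (hSS : LocStencilW (S - S') (R / 2) εS)
    (hR : 0 < R) (N : ℕ) :
    VertexFamilyW (vertexOfK K N S - vertexOfK K' N S') N (R / 2) (εK * Bs + BK' * εS) := by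
  classical
  intro μ y
  have hR2 : 0 < R / 2 := by linarith
  obtain ⟨hslD, hleD⟩ := colH_slices hKK N μ y
  obtain ⟨hsl', hle'⟩ := colH_slices hK' N μ y
  -- the telescoping identity, slice by slice
  have hident : ∀ κ' : Fin (d + 1), wsum (colH K N μ y κ') (S κ') - wsum (colH K' N μ y κ') (S' κ') =
      wsum (colH (K - K') N μ y κ') (S κ') + wsum (colH K' N μ y κ') (S κ' - S' κ') := by
    intro κ'
    rw [wsum_sub_wsum (fun u => abs_colH_le_W hK hR.le N μ y κ' u) (fun u => abs_colH_le_W hK' hR.le N μ y κ' u)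
      (fun u => (hS κ' u).biLoc) (fun u => (hS' κ' u).biLoc) hR2 hK.nonneg hK'.nonneg]
    have hcol : colH K N μ y κ' - colH K' N μ y κ' = colH (K - K') N μ y κ' :=
      funext fun u => (colH_sub K K' N μ y κ' u).symm
    rw [hcol]
  have hterm : ∀ κ' : Fin (d + 1), BiW (wsum (colH K N μ y κ') (S κ') - wsum (colH K' N μ y κ') (S' κ'))
      ((N : ℤ) • y) ((N : ℤ) • y) (R / 2)
      ((∑' u, |colH (K - K') N μ y κ' u| * Real.exp (R * l1 (u - (N : ℤ) • y))) * Bs +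
        (∑' u, |colH K' N μ y κ' u| * Real.exp (R * l1 (u - (N : ℤ) • y))) * εS) := fun κ' => by
    rw [hident κ']
    exact (biW_wsum_W (fun U => (hslD κ').sum_le_tsum U (fun u _ => by positivity)) (fun u => hS κ' u) hR).add
      (biW_wsum_W (fun U => (hsl' κ').sum_le_tsum U (fun u _ => by positivity)) (fun u => hSS κ' u) hR)
  have hsum := BiW.finset_sum (Finset.univ : Finset (Fin (d + 1))) (fun κ' _ => hterm κ')
  have hfun : (vertexOfK K N S - vertexOfK K' N S') μ y =
      ∑ κ' : Fin (d + 1), (wsum (colH K N μ y κ') (S κ') - wsum (colH K' N μ y κ') (S' κ')) := by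
    rw [Finset.sum_sub_distrib, ← vertexOfK_eq_sum, ← vertexOfK_eq_sum]
    rfl
  show BiW ((vertexOfK K N S - vertexOfK K' N S') μ y) ((N : ℤ) • y) ((N : ℤ) • y) (R / 2) (εK * Bs + BK' * εS)
  rw [hfun]
  refine hsum.mono ?_
  rw [Finset.sum_add_distrib, ← Finset.sum_mul, ← Finset.sum_mul]
  exact add_le_add (mul_le_mul_of_nonneg_right hleD hS.nonneg) (mul_le_mul_of_nonneg_right hle' hSS.nonneg)

/-- **RATE FORM**: `K_j → K∞` geometrically in `ColW` (rate `R`) and `S_j → S∞` geometrically in `LocStencilW` (rate `R/2`) with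
uniform data ⟹ `VertexFamilyW (vertexOfK K_j N S_j − vertexOfK K∞ N S∞) N (R/2) ((c_K·B_s + B_K·c_S)·θ^j)`. [folklore] -/
theorem vertexFamilyW_vertexOfK_rate {K : ℕ → MKer (d + 1) (Fib d)} {Kinf : MKer (d + 1) (Fib d)}
    {S : ℕ → Fin (d + 1) → (Fin (d + 1) → ℤ) → MKer (d + 1) (Fib d)}
    {Sinf : Fin (d + 1) → (Fin (d + 1) → ℤ) → MKer (d + 1) (Fib d)} {R BK cK Bs cS θ : ℝ}
    (hK : ∀ j, ColW (K j) R BK) (hKinf : ColW Kinf R BK) (hKrate : ∀ j, ColW (K j - Kinf) R (cK * θ ^ j))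
    (hS : ∀ j, LocStencilW (S j) (R / 2) Bs) (hSinf : LocStencilW Sinf (R / 2) Bs)
    (hSrate : ∀ j, LocStencilW (S j - Sinf) (R / 2) (cS * θ ^ j)) (hR : 0 < R) (N : ℕ) (j : ℕ) :
    VertexFamilyW (vertexOfK (K j) N (S j) - vertexOfK Kinf N Sinf) N (R / 2) ((cK * Bs + BK * cS) * θ ^ j) :=
  (vertexFamilyW_vertexOfK_sub (hK j) hKinf (hKrate j) (hS j) hSinf (hSrate j) hR N).mono (le_of_eq (by ring))

/-- **END-TO-END FROM THE PRIMITIVES `(K_j, S_j, W_j)`** — the literal shape `hessKer K (vertexOfK K N S) W` of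
`OneStepKernelFamily.TstepOf`: resolvent columns in `ColW` at rate `R` (bound `B_K`, geometric deviations `c_K θ^j`), stencil tables
in `LocStencilW` at rate `R/2` (`B_s`, `c_S θ^j`), second-order vertices in `VertexFamily₂W` at rate `R` (`B_W`, `c_W θ^j`), `0 < R`,
`1 ≤ N` ⟹ `RateCertificate.GeomRate` of the second moments with constant
`betaPrime510 (d+1) (lipW B_K B_K (B_K B_s) (B_K B_s) B_W c_K (c_K B_s + B_K c_S) c_W) (R·N)` — decay length = the resolvent's
column rate times the blocking. [folklore] -/
theorem geomRate_secondMoment_hessKer_primitivesW {K : ℕ → MKer (d + 1) (Fib d)} {Kinf : MKer (d + 1) (Fib d)}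
    {S : ℕ → Fin (d + 1) → (Fin (d + 1) → ℤ) → MKer (d + 1) (Fib d)}
    {Sinf : Fin (d + 1) → (Fin (d + 1) → ℤ) → MKer (d + 1) (Fib d)}
    {W : ℕ → Fin (d + 1) → (Fin (d + 1) → ℤ) → Fin (d + 1) → (Fin (d + 1) → ℤ) → MKer (d + 1) (Fib d)}
    {Winf : Fin (d + 1) → (Fin (d + 1) → ℤ) → Fin (d + 1) → (Fin (d + 1) → ℤ) → MKer (d + 1) (Fib d)}
    {R BK cK Bs cS BW cW θ : ℝ} {N : ℕ}
    (hK : ∀ j, ColW (K j) R BK) (hKinf : ColW Kinf R BK) (hKrate : ∀ j, ColW (K j - Kinf) R (cK * θ ^ j))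
    (hS : ∀ j, LocStencilW (S j) (R / 2) Bs) (hSinf : LocStencilW Sinf (R / 2) Bs)
    (hSrate : ∀ j, LocStencilW (S j - Sinf) (R / 2) (cS * θ ^ j))
    (hW : ∀ j, VertexFamily₂W (W j) N R BW) (hWinf : VertexFamily₂W Winf N R BW)
    (hWrate : ∀ j, VertexFamily₂W (W j - Winf) N R (cW * θ ^ j)) (hR : 0 < R) (hN : 1 ≤ N) (μ ν : Fin (d + 1)) :
    RateCertificate.GeomRate (fun j => B12Beta.secondMoment (hessKer (K j) (vertexOfK (K j) N (S j)) (W j)) μ ν)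
      (B12Beta.secondMoment (hessKer Kinf (vertexOfK Kinf N Sinf) Winf) μ ν)
      (betaPrime510 (d + 1) (lipW BK BK (BK * Bs) (BK * Bs) BW cK (cK * Bs + BK * cS) cW) (R * N)) θ :=
  geomRate_secondMoment_hessKer_halfV (V := fun j => vertexOfK (K j) N (S j)) (Vinf := vertexOfK Kinf N Sinf) hK hKinf hKrate
    (fun j => vertexFamilyW_vertexOfK (hK j) (hS j) hR N) (vertexFamilyW_vertexOfK hKinf hSinf hR N)
    (fun j => vertexFamilyW_vertexOfK_rate hK hKinf hKrate hS hSinf hSrate hR N j) hW hWinf hWrate hR hN μ ν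

/-- … and the road-A2 socket `Drift.OneLoopDrift` from the primitives, defect `c₀/(1−θ)`. [folklore] -/
theorem oneLoopDrift_secondMoment_hessKer_primitivesW {K : ℕ → MKer (d + 1) (Fib d)} {Kinf : MKer (d + 1) (Fib d)}
    {S : ℕ → Fin (d + 1) → (Fin (d + 1) → ℤ) → MKer (d + 1) (Fib d)}
    {Sinf : Fin (d + 1) → (Fin (d + 1) → ℤ) → MKer (d + 1) (Fib d)}
    {W : ℕ → Fin (d + 1) → (Fin (d + 1) → ℤ) → Fin (d + 1) → (Fin (d + 1) → ℤ) → MKer (d + 1) (Fib d)}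
    {Winf : Fin (d + 1) → (Fin (d + 1) → ℤ) → Fin (d + 1) → (Fin (d + 1) → ℤ) → MKer (d + 1) (Fib d)}
    {R BK cK Bs cS BW cW θ : ℝ} {N : ℕ}
    (hK : ∀ j, ColW (K j) R BK) (hKinf : ColW Kinf R BK) (hKrate : ∀ j, ColW (K j - Kinf) R (cK * θ ^ j))
    (hS : ∀ j, LocStencilW (S j) (R / 2) Bs) (hSinf : LocStencilW Sinf (R / 2) Bs)
    (hSrate : ∀ j, LocStencilW (S j - Sinf) (R / 2) (cS * θ ^ j))
    (hW : ∀ j, VertexFamily₂W (W j) N R BW) (hWinf : VertexFamily₂W Winf N R BW)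
    (hWrate : ∀ j, VertexFamily₂W (W j - Winf) N R (cW * θ ^ j)) (hR : 0 < R) (hN : 1 ≤ N) (hθ0 : 0 ≤ θ) (hθ1 : θ < 1)
    (μ ν : Fin (d + 1)) :
    Drift.OneLoopDrift (B12Beta.secondMoment (hessKer Kinf (vertexOfK Kinf N Sinf) Winf) μ ν)
      (betaPrime510 (d + 1) (lipW BK BK (BK * Bs) (BK * Bs) BW cK (cK * Bs + BK * cS) cW) (R * N) / (1 - θ))
      (fun j => B12Beta.secondMoment (hessKer (K j) (vertexOfK (K j) N (S j)) (W j)) μ ν) :=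
  (geomRate_secondMoment_hessKer_primitivesW hK hKinf hKrate hS hSinf hSrate hW hWinf hWrate hR hN μ ν).drift hθ0 hθ1

/-- **… FROM POINTWISE DATA ON THE PRIMITIVES** (`HessKerRate` §6's hypotheses: `Decays (K j) C δK`, `LocStencil (S j) Cs δS`,
`VertexFamily₂ (W j) N Cw δW` + geometric deviations), at any target rate `0 < R` with `R < δK`, `R/2 < δS`, `R < δW`: the same
`GeomRate` at rate `R·N`, paying `Zl` ONCE per primitive (`|Fib d|·Zl(δK−R)` for the resolvent, `|Fib d|²·Zl(δS−R/2)²` for the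
stencils, `|Fib d|²·Zl(δW−R)²` for the second-order vertices) — against rate `δ/8` of the pointwise chain. [folklore] -/
theorem geomRate_secondMoment_hessKer_primitivesW_of_pointwise {K : ℕ → MKer (d + 1) (Fib d)} {Kinf : MKer (d + 1) (Fib d)}
    {S : ℕ → Fin (d + 1) → (Fin (d + 1) → ℤ) → MKer (d + 1) (Fib d)}
    {Sinf : Fin (d + 1) → (Fin (d + 1) → ℤ) → MKer (d + 1) (Fib d)}
    {W : ℕ → Fin (d + 1) → (Fin (d + 1) → ℤ) → Fin (d + 1) → (Fin (d + 1) → ℤ) → MKer (d + 1) (Fib d)}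
    {Winf : Fin (d + 1) → (Fin (d + 1) → ℤ) → Fin (d + 1) → (Fin (d + 1) → ℤ) → MKer (d + 1) (Fib d)}
    {R C cK δK Cs cS δS Cw cW δW θ : ℝ} {N : ℕ}
    (hK : ∀ j, Decays (K j) C δK) (hKinf : Decays Kinf C δK) (hKrate : ∀ j, Decays (K j - Kinf) (cK * θ ^ j) δK)
    (hS : ∀ j, LocStencil (S j) Cs δS) (hSinf : LocStencil Sinf Cs δS) (hSrate : ∀ j, LocStencil (S j - Sinf) (cS * θ ^ j) δS)
    (hW : ∀ j, VertexFamily₂ (W j) N Cw δW) (hWinf : VertexFamily₂ Winf N Cw δW)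
    (hWrate : ∀ j, VertexFamily₂ (W j - Winf) N (cW * θ ^ j) δW)
    (hR : 0 < R) (hRK : R < δK) (hRS : R / 2 < δS) (hRW : R < δW) (hN : 1 ≤ N) (μ ν : Fin (d + 1)) :
    RateCertificate.GeomRate (fun j => B12Beta.secondMoment (hessKer (K j) (vertexOfK (K j) N (S j)) (W j)) μ ν)
      (B12Beta.secondMoment (hessKer Kinf (vertexOfK Kinf N Sinf) Winf) μ ν)
      (betaPrime510 (d + 1)
        (lipW ((Fintype.card (Fib d) : ℝ) * C * Zl (d + 1) (δK - R)) ((Fintype.card (Fib d) : ℝ) * C * Zl (d + 1) (δK - R))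
          ((Fintype.card (Fib d) : ℝ) * C * Zl (d + 1) (δK - R) * ((Fintype.card (Fib d) : ℝ) ^ 2 * Cs * Zl (d + 1) (δS - R / 2) ^ 2))
          ((Fintype.card (Fib d) : ℝ) * C * Zl (d + 1) (δK - R) * ((Fintype.card (Fib d) : ℝ) ^ 2 * Cs * Zl (d + 1) (δS - R / 2) ^ 2))
          ((Fintype.card (Fib d) : ℝ) ^ 2 * Cw * Zl (d + 1) (δW - R) ^ 2)
          ((Fintype.card (Fib d) : ℝ) * cK * Zl (d + 1) (δK - R))
          ((Fintype.card (Fib d) : ℝ) * cK * Zl (d + 1) (δK - R) * ((Fintype.card (Fib d) : ℝ) ^ 2 * Cs * Zl (d + 1) (δS - R / 2) ^ 2) +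
            (Fintype.card (Fib d) : ℝ) * C * Zl (d + 1) (δK - R) * ((Fintype.card (Fib d) : ℝ) ^ 2 * cS * Zl (d + 1) (δS - R / 2) ^ 2))
          ((Fintype.card (Fib d) : ℝ) ^ 2 * cW * Zl (d + 1) (δW - R) ^ 2))
        (R * N)) θ := by
  have hθK : ∀ j, ColW (K j - Kinf) R ((Fintype.card (Fib d) : ℝ) * cK * Zl (d + 1) (δK - R) * θ ^ j) := fun j =>
    (colW_of_decays (hKrate j) hRK).mono (le_of_eq (by ring))
  have hθS : ∀ j, LocStencilW (S j - Sinf) (R / 2) ((Fintype.card (Fib d) : ℝ) ^ 2 * cS * Zl (d + 1) (δS - R / 2) ^ 2 * θ ^ j) :=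
    fun j => (locStencilW_of_locStencil (hSrate j) hRS).mono (le_of_eq (by ring))
  have hθW : ∀ j, VertexFamily₂W (W j - Winf) N R ((Fintype.card (Fib d) : ℝ) ^ 2 * cW * Zl (d + 1) (δW - R) ^ 2 * θ ^ j) :=
    fun j => (vertexFamily₂W_of_vertexFamily₂ (hWrate j) hRW).mono (le_of_eq (by ring))
  exact geomRate_secondMoment_hessKer_primitivesW (fun j => colW_of_decays (hK j) hRK) (colW_of_decays hKinf hRK) hθK
    (fun j => locStencilW_of_locStencil (hS j) hRS) (locStencilW_of_locStencil hSinf hRS) hθS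
    (fun j => vertexFamily₂W_of_vertexFamily₂ (hW j) hRW) (vertexFamily₂W_of_vertexFamily₂ hWinf hRW) hθW hR hN μ ν

end VertexW

/-! ## §8 (v1.1) UNITS: the weighted classes under fibrewise rescaling `HessKerRate.scaleK`

RULING (R25-1): (CONV-C) is posed for the RESCALED constituents `𝔄_j = u_j A_j u_j`, … (`HessKerRate` §5, `hessKer_scaleK`).  The
weighted classes transport under `scaleK u v` exactly like the pointwise ones (`decays_scaleK`, `biLoc_scaleK`): bound `U·B·U′`,
SAME rate — so a supplier may rescale before or after passing to weighted norms. [folklore] -/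

section Units

open Literature.MathematicalPhysics.QuantumFieldTheory.Balaban1983to89.Beta.HessKerRate (scaleK scaleK_apply)

omit [Fintype F] in
/-- One rescaled weighted entry. [folklore] -/
theorem abs_scaleK_mul_le {u v : F → ℝ} {U U' : ℝ} (hu : ∀ a, |u a| ≤ U) (hv : ∀ b, |v b| ≤ U') (hU : 0 ≤ U)
    (K : MKer D F) (x y : Fin D → ℤ) (a b : F) (e : ℝ) (he : 0 ≤ e) :
    |scaleK u v K x y a b| * e ≤ U * U' * (|K x y a b| * e) := by
  rw [scaleK_apply, abs_mul, abs_mul]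
  have h1 : |u a| * |K x y a b| * |v b| ≤ U * |K x y a b| * U' :=
    mul_le_mul (mul_le_mul_of_nonneg_right (hu a) (abs_nonneg _)) (hv b) (abs_nonneg _) (by positivity)
  calc |u a| * |K x y a b| * |v b| * e ≤ U * |K x y a b| * U' * e := mul_le_mul_of_nonneg_right h1 he
    _ = U * U' * (|K x y a b| * e) := by ring

/-- Rescaling transports `ColW`: bound `U·B·U′`, same rate (`0 ≤ U, U′` recorded for the empty fibre). [folklore] -/
theorem colW_scaleK {u v : F → ℝ} {U U' : ℝ} (hu : ∀ a, |u a| ≤ U) (hv : ∀ b, |v b| ≤ U') (hU : 0 ≤ U) (hU' : 0 ≤ U')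
    {K : MKer D F} {R B : ℝ} (hK : ColW K R B) : ColW (scaleK u v K) R (U * B * U') := by
  have hB := hK.1
  refine ⟨by positivity, fun y b s => ?_⟩
  calc ∑ x ∈ s, ∑ a, |scaleK u v K x y a b| * Real.exp (R * l1 (x - y))
      ≤ ∑ x ∈ s, ∑ a, U * U' * (|K x y a b| * Real.exp (R * l1 (x - y))) :=
        Finset.sum_le_sum fun x _ => Finset.sum_le_sum fun a _ =>
          abs_scaleK_mul_le hu hv hU K x y a b _ (Real.exp_pos _).le
    _ = U * U' * ∑ x ∈ s, ∑ a, |K x y a b| * Real.exp (R * l1 (x - y)) := by simp only [Finset.mul_sum]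
    _ ≤ U * U' * B := mul_le_mul_of_nonneg_left (hK.2 y b s) (by positivity)
    _ = U * B * U' := by ring

/-- Rescaling transports `RowW`. [folklore] -/
theorem rowW_scaleK {u v : F → ℝ} {U U' : ℝ} (hu : ∀ a, |u a| ≤ U) (hv : ∀ b, |v b| ≤ U') (hU : 0 ≤ U) (hU' : 0 ≤ U')
    {K : MKer D F} {R B : ℝ} (hK : RowW K R B) : RowW (scaleK u v K) R (U * B * U') := by
  have hB := hK.1
  refine ⟨by positivity, fun x a s => ?_⟩
  calc ∑ y ∈ s, ∑ b, |scaleK u v K x y a b| * Real.exp (R * l1 (x - y))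
      ≤ ∑ y ∈ s, ∑ b, U * U' * (|K x y a b| * Real.exp (R * l1 (x - y))) :=
        Finset.sum_le_sum fun y _ => Finset.sum_le_sum fun b _ =>
          abs_scaleK_mul_le hu hv hU K x y a b _ (Real.exp_pos _).le
    _ = U * U' * ∑ y ∈ s, ∑ b, |K x y a b| * Real.exp (R * l1 (x - y)) := by simp only [Finset.mul_sum]
    _ ≤ U * U' * B := mul_le_mul_of_nonneg_left (hK.2 x a s) (by positivity)
    _ = U * B * U' := by ring

/-- Rescaling transports `BiW`. [folklore] -/
theorem biW_scaleK {u v : F → ℝ} {U U' : ℝ} (hu : ∀ a, |u a| ≤ U) (hv : ∀ b, |v b| ≤ U') (hU : 0 ≤ U) (hU' : 0 ≤ U')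
    {K : MKer D F} {p q : Fin D → ℤ} {R B : ℝ} (hK : BiW K p q R B) : BiW (scaleK u v K) p q R (U * B * U') := by
  intro s t
  calc ∑ x ∈ s, ∑ y ∈ t, ∑ a, ∑ b, |scaleK u v K x y a b| * Real.exp (R * (l1 (x - p) + l1 (y - q)))
      ≤ ∑ x ∈ s, ∑ y ∈ t, ∑ a, ∑ b, U * U' * (|K x y a b| * Real.exp (R * (l1 (x - p) + l1 (y - q)))) :=
        Finset.sum_le_sum fun x _ => Finset.sum_le_sum fun y _ => Finset.sum_le_sum fun a _ => Finset.sum_le_sum fun b _ =>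
          abs_scaleK_mul_le hu hv hU K x y a b _ (Real.exp_pos _).le
    _ = U * U' * ∑ x ∈ s, ∑ y ∈ t, ∑ a, ∑ b, |K x y a b| * Real.exp (R * (l1 (x - p) + l1 (y - q))) := by
        simp only [Finset.mul_sum]
    _ ≤ U * U' * B := mul_le_mul_of_nonneg_left (hK s t) (by positivity)
    _ = U * B * U' := by ring

/-- Rescaling transports `VertexFamilyW`. [folklore] -/
theorem vertexFamilyW_scaleK {u v : F → ℝ} {U U' : ℝ} (hu : ∀ a, |u a| ≤ U) (hv : ∀ b, |v b| ≤ U') (hU : 0 ≤ U)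
    (hU' : 0 ≤ U') {V : Fin D → (Fin D → ℤ) → MKer D F} {N : ℕ} {R B : ℝ} (hV : VertexFamilyW V N R B) :
    VertexFamilyW (fun μ y => scaleK u v (V μ y)) N R (U * B * U') :=
  fun μ y => biW_scaleK hu hv hU hU' (hV μ y)

/-- Rescaling transports `VertexFamily₂W`. [folklore] -/
theorem vertexFamily₂W_scaleK {u v : F → ℝ} {U U' : ℝ} (hu : ∀ a, |u a| ≤ U) (hv : ∀ b, |v b| ≤ U') (hU : 0 ≤ U)
    (hU' : 0 ≤ U') {W : Fin D → (Fin D → ℤ) → Fin D → (Fin D → ℤ) → MKer D F} {N : ℕ} {R B : ℝ}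
    (hW : VertexFamily₂W W N R B) : VertexFamily₂W (fun μ y ν y' => scaleK u v (W μ y ν y')) N R (U * B * U') :=
  fun μ y ν y' => biW_scaleK hu hv hU hU' (hW μ y ν y')

end Units

end

end Literature.MathematicalPhysics.QuantumFieldTheory.Balaban1983to89.Beta.HessKerSchur
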